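import Mathlib
import HarnessLib
import HarnessLib.Audit
import Summits.AtomisticToContinuum.Statement
import Summits.AtomisticToContinuum.HydrodynamicLimit.Theorems.ImplosionDichotomyHsEosLowDensity
import Summits.AtomisticToContinuum.HydrodynamicLimit.Theorems.EnskogAdjointDualityDualityReductionEosWindow
import Summits.AtomisticToContinuum.HydrodynamicLimit.Theorems.EnskogAdjointDualityDualityReductionProfiles
import Summits.AtomisticToContinuum.HydrodynamicLimit.Theorems.EnskogAdjointDualityDualityReductionLBound
import Summits.AtomisticToContinuum.HydrodynamicLimit.Theorems.EnskogAdjointDualityDualityReductionLMeasurable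
import Summits.AtomisticToContinuum.HydrodynamicLimit.Theorems.EnskogAdjointDualityDualityReductionFSide
import Summits.AtomisticToContinuum.HydrodynamicLimit.Theorems.EnskogAdjointDualityDualityReductionInitial
import Summits.AtomisticToContinuum.HydrodynamicLimit.Theorems.EnskogAdjointDualityDualityReductionAssembly
import Summits.AtomisticToContinuum.HydrodynamicLimit.Theorems.EnskogAdjointDualityDualityReductionCZero
import Summits.AtomisticToContinuum.HydrodynamicLimit.Theorems.EnskogAdjointDualityDualityReductionTimeZero
import Summits.AtomisticToContinuum.HydrodynamicLimit.Theorems.JParityClosureParityInBandSmoothTest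
import Summits.AtomisticToContinuum.HydrodynamicLimit.Theorems.JParityClosureParityInBandEnergyTight
import HarnessLib.Audit.Status.Attr

/-!
Route: EnskogAdjointDuality

CLOSED (refuted) 2026-08-20T17:13:57Z by gate — reason: refuted:stmt-AtomisticToContinuum-11592 (AdjointEnskogTestFamilyR) by Summit.AtomisticToContinuum.HydrodynamicLimit.Theorems.EnskogAdjointDuality.not_AdjointEnskogTestFamilyR — note: repair grace of 72.0 h (deadline 2026-08-20T17:11:16Z) expired without a repair — closed by the gate. The file is kept as the record of this route; refuted decls are indexed as negative knowledge (`ledger negatives`).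

# Route EnskogAdjointDuality — LLN-scale duality for the exact empirical Enskog identity — backward
linearised-Enskog test functions leave one collision residual (Hoeffding remainder) as the whole
microscopic crux

It suffices to show X = CollisionResidualVanishes ∧ AdjointEnskogTestFamilyR, on top of the one
standing (PROVED) support fact HsEosLowDensity
(hard-sphere EOS real-analytic at low packing). Since the D-0032 re-type of the conjunct
(2026-08-16, p126922) `HydrodynamicLimit` is
PACKING-GUARDED (∃ η₀ outermost; only classical solutions with ρ_t(x)σ³ < η₀ on [0,T)×𝕋³ are spoken
about), so the packing guards of K1/K2R
are discharged by the Statement's own guard with η₀ := the EOS window η₁ of HsEosLowDensity, and the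
open-problem support
DiluteSelfConsistency (shared stmt-AtomisticToContinuum-3091) is no longer load-bearing for this
route. [Card disjoint-regularity-empirical-enskog, constructive part (P3)
"LLN-scale duality escape"; bookkeeping: contact value Y = (3/2π) f_ex′ inside the linearised
operator, Hoeffding centring ½∫⟨f,Lφ⟩.]
Never take a norm of μ^N_t − f_t (the card's disjoint-regularity count shows every Banach fixed
point on the exact empirical Enskog equation
is supercritical); instead test the EXACT finite-N collision identity of the empirical measure
against an explicit family of backward test
functions φ^N(s,x,v) = α+β·v+γ|v|²/2 + κ/λ_N (hydrodynamic up to O(1/λ_N), λ_N = Nε_N² ≍ σ²N^(1/3))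
built on the Euler local Maxwellian
f_s = ρ_s M_(u_s,θ_s) and the test-side linearised Enskog operator L^N_s (full pair increment,
partner drawn from Y(σ³ρ_s)·f_s at distance
ε_N). The exact pathwise identity ⟨μ^N_t − f_t, φ_t⟩ = ⟨μ^N_0 − f_0, φ_0⟩ + ∫₀ᵗ⟨μ^N_s − f_s,
(D+L^N_s)φ_s⟩ds + 𝓡_N[φ] − Res_N[φ] leaves:
CollisionResidualVanishes (K1) — the collision residual 𝓡_N[φ] = (collision sum of
φ-increments)/(N+1) − ∫⟨μ^N_s, L^N_sφ_s⟩ds + ½∫⟨f_s, L^N_sφ_s⟩ds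
(the degenerate second-order Hoeffding part of the collision U-statistic plus the conditional-mean
chaos defect) tends to 0 in mean square
for every admissible family, along solutions whose packing stays inside the EOS window (guarded like
K2R since rev 8); AdjointEnskogTestFamilyR (K2R, the 2026-08-15 repair of the refuted
AdjointEnskogTestFamily) — along every
classical hs-Euler solution whose packing stays inside an EOS window (0,η₁) on which f_ex is
analytic with f_ex′ > 0 and (ηZ)′ > 0, for smooth
hydrodynamic terminal data there is an admissible family with, for all large N, defect
|(D+L^N_s)φ^N| ≤ η_N(1+|v|²) → 0, convergent
coefficients at s = 0 and Enskog defect Res_N[φ^N] of f → 0 (a linear kinetic PDE statement). Then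
the four terms are: t = 0 LLN
(hypothesis), η_N × conserved energy, K1, K2R — giving the conjunct through the in-band duality
glue, which since rev 12 (2026-08-16) is PROVED INSIDE the crux-only deciding
theorem `closes` (EOS window η₁ of HsEosLowDensity = the Statement's η₀; the Statement's guard on
[0,T) feeds K1/K2R; smooth-χ L² core,
Chebyshev field by field, momentum by coordinates, uniform approximation of continuous χ).
[Pre-D-0032 chain kept as proved records: DualityReduction → the unguarded shared waypoint
L2HydroFields (needs DiluteSelfConsistency) and
L2ToHydroLimit (Chebyshev; re-lands through HydrodynamicLimit.of_unguarded).]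
Lean: `CollisionResidualVanishes ∧ AdjointEnskogTestFamilyR`

## Assembly
DECIDING THEOREM (D-0027 §2.1; CRUX-ONLY since rev 12, 2026-08-16T23:53Z, human ruling 2026-08-16):
`theorem closes (h₁ : CollisionResidualVanishes)
(h₂ : AdjointEnskogTestFamilyR) : _root_.HydrodynamicLimit` — the hypotheses are EXACTLY the two
cruxes and the conclusion is the sub-problem
Statement decl `HydrodynamicLimit` BY NAME (packing-guarded form). The proved support
HsEosLowDensity enters through `HsEosLowDensity_holds`
(eos_window), and the in-band duality glue — the statement of the support record
DualityReductionInBand — is proved INLINE (≈320 lines, axioms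
{propext, Classical.choice, Quot.sound}, native audit ok with hypotheses [K1, K2R]) from the landed
ROUTE-FILE-INDEPENDENT helpers
Theorems/EnskogAdjointDualityDualityReduction{EosWindow,Profiles,LBound,LMeasurable,FSide,Initial,Assembly,CZero,TimeZero}.lean
and
Theorems/JParityClosureParityInBand{SmoothTest,EnergyTight}.lean, now imported by the route file
(smooth_core, combo_tendsto_of_pos and
dualityReduction_proof themselves cannot be invoked inside closes: their files import this route
file). Proof: η₀ := η₁; σ₀ := min(σ₀(K1),
σ₀(K2R(η₁)), 1/2); t = 0 is the hypothesis; t > 0: the smooth-χ L² core verbatim as in smooth_core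
(K2R's backward family, K1's residual AT THAT
FAMILY, duality_assembly, initial_term_tendsto, abs_I3_add_half_I2_le, contactValue_window), raw ↔
fields (avg_chi_affine_eq_combo,
integral_ft_chi_affine_eq_combo), Chebyshev per field with momentum by coordinates, then
tendstoHydroFieldsAt_of_isSmooth with
energy_tight_of_tendstoHydroFieldsAt_zero. K1 is used only on K2R's approximately-dual families: if
K1 is ever restated with the
approximate-duality premise (R2 of verdict_ECR.md on stmt-AtomisticToContinuum-9169), closes needs
one more argument (K2R's ⟨η, hη, hev⟩) and
nothing else. EquilibriumCollisionResidual is the special case of K1 at constant profiles and is not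
a premise of `closes`; at rev 13 the Assembly item was RESTATED to the crux-only form
`CollisionResidualVanishes → AdjointEnskogTestFamilyR → HydrodynamicLimit` (literally the type of
`closes`, so it is proved by `closes`) and this
route's link to the open-problem support DiluteSelfConsistency (pre-D-0032 guard, not load-bearing;
a conjecture-grade statement may ride on a
route only as a crux) was DROPPED. The pre-D-0032 deciding theorem was `hL (hD hE hS h₁ h₂)` through
DualityReduction (HsEosLowDensity → DiluteSelfConsistency →
K1 → K2R → L2HydroFields, PROVED) and L2ToHydroLimit (L2HydroFields → HydrodynamicLimit, proved for
the unguarded conjunct); both stay as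
records (rev 11's interim deciding theorem `hD hE h₁ h₂` took DualityReductionInBand itself as a
hypothesis — a non-crux binder, hence the
rev-12 inlining). REPAIR LOG: AdjointEnskogTestFamily
(stmt-AtomisticToContinuum-9168) was refuted-misstated by
Theorems/EnskogAdjointDualityAdjointEnskogTestFamilyRefutation.lean (no tie of (ρ,u,θ)
to the gas: the constant state at packing 1000 sits on the junk EOS branch, Y = 0, L^N ≡ 0, and free
transport breaks the quadratic-in-v form);
it stays in the file as a negative edge. K2R adds the packing guard and explicit EOS-window
hypotheses and asks (ii)–(iii) only eventually in N
(at N = 0, λ_0 = 0 removes both L^0 and the corrector, which made the old (iii) false for e ≠ 0 even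
under a guard — repairing planner's check).
D-0032 (2026-08-16): Statement re-typed to the
packing-guarded form; closes re-supplied through DualityReductionInBand (rev 11) and made crux-only
by inlining that glue (rev 12). This route re-opens, in conforming form, the line
of the retired route-AtomisticToContinuum-EmpiricalEnskogDuality.

Rationale: WHY THIS LINE. Mechanism: linearised DUALITY for the exact empirical-measure Enskog identity
(Bogolyubov1975; PulvirentiSimonella2016, arXiv:1504.03215;
PulvirentiSimonellaTrushechkin2018) around the strong Euler solution, in the spirit of the L²
test-function method of BGSR2017 (adjoint
linearised Boltzmann flow on test functions, Boltzmann–Grad, global equilibrium) transplanted to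
FIXED reduced density (Enskog shifts ±ε_N and
contact value Y survive because λ_Nε_N = σ³) and to a NON-equilibrium local-Maxwellian background
(Hilbert expansion OF THE TEST FUNCTION:
adjoint linearised hs-Euler for (α,β,γ) plus a Chapman–Enskog-type corrector κ, Caflisch1980 /
GuoJangJiang2009 / Lachowicz1998 technology,
but linear). Imported from statistics: the Hoeffding/Hájek decomposition of the collision sum as a
U-statistic over colliding pairs
(Hoeffding1963) — its first-order projection is EXACTLY ∫⟨μ^N_s, L^N_sφ_s⟩ds − ½∫⟨f_s,L^N_sφ_s⟩ds,
so K1 isolates the degenerate remainder +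
the flux-weighted, time-averaged conditional-MEAN chaos defect: molecular chaos in the weakest form
the conjunct can live on (relative o(1)
accuracy of Enskog contact statistics in the mean, no law-level factorisation, no norm on μ^N − f).
What it does that the 40 open routes do
not: no relative entropy / Boltzmann hypothesis (RelEntropyErgodic, ChapmanEnskogCorrector,
KnudsenRate), no compactness / Young measures /
weak–strong uniqueness (CollisionMeasureChaos, DissipativeWeakStrong), no cumulant hierarchy
(DenseKineticExpansion), no score calculus on
the data (OneParticleInfluence, AthermalWard): the PDE side is a LINEAR backward kinetic equation,
the microscopic side one mean-square
statement about an explicit trajectory functional. Negatives index empty at filing (2026-08-15).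

RANKED CRUXES. #0 L2HydroFields (target) — the shared typed waypoint
(stmt-AtomisticToContinuum-0800): for all continuous profiles ∃σ₀ ∀σ<σ₀ ∀ classical hs-Euler
solutions on [0,T) ∀ flows, if the local Gibbs fields converge at t = 0 then for every t < T and
continuous χ the three empirical fields converge to (ρ, ρu, E)(t) in mean square (lintegral form).
Entered through DualityReduction (PROVED, under DiluteSelfConsistency); since D-0032 closes reaches
the guarded conjunct directly
(DualityReductionInBand) and this unguarded waypoint stays as the typed meeting point with other
routes. [deps: DualityReduction] [difficulty: open-problem] (why it might fail: in substance the
open conjunct itself (L² ⇔ in probability here by energy conservation); deterministic spheres at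
fixed σ may fail to keep local equilibrium on Euler times (Spohn1991 I.3).) [Spohn1991,
OllaVaradhanYau1993]
#2 CollisionResidualVanishes (crux) — COLLISION RESIDUAL → 0 IN MEAN SQUARE (card crux 1 + crux 3,
LLN scale, Y-corrected; PACKING-GUARDED since rev 8, 2026-08-15, stmt-14658 replacing stmt-9167 1:1
on the route-review refuters' advice). For every EOS window η₁ > 0 on which f_ex is real-analytic
with f_ex′ > 0 and (ηZ)′ > 0 (the K2R prefix): for continuous profiles, σ < σ₀, every classical
hs-Euler solution (ρ,u,θ) on [0,T) matched to the data by the t = 0 LLN hypothesis, every family of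
flows, every t < T with packing ρ_s(x)σ³ < η₁ on [0,t]×𝕋³, and EVERY admissible test family
φ^N(s,x,v) = α^N(s,x) + β^N(s,x)·v + γ^N(s,x)|v|²/2 + κ^N(s,x,v)/λ_N (typed with the coefficient
triple c^N = (α^N,β^N,γ^N) : ℝ × ℝ³ × ℝ, jointly continuous, sup-bounded and uniformly Lipschitz in
x for the torus metric, and the kinetic corrector κ^N continuous with |κ^N| ≤ C(1+|v|²) and
|κ^N(s,x,v) − κ^N(s,x′,v′)| ≤ C(1+|v|²+|v′|²)(dist(x,x′)+|v−v′|), one C for all N, s): ∫⁻ 𝓡_N[φ^N]²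
d(localGibbsLaw) → 0, where 𝓡_N[φ](z) = (N+1)⁻¹ Σ_{collision times s ∈ (0,t]} Σ_{ordered contact
pairs (i,j)} [φ(s,x_i,v_i) − φ(s,x_i,v_i^pre)] − ∫₀ᵗ ⟨μ^N_s, L^N_s φ_s⟩ ds + ½ ∫₀ᵗ∫∫ f_s L^N_sφ_s,
with f_s = ρ_s·localMaxwellian 1 θ_s u_s, λ_N = N ε_N², Y(η) = (3/2π) f_ex′(η), (L^N_sφ)(x,v) = λ_N
∫_{S²}∫ ((v−w)·ω)₊ Y(σ³ρ_s(x+εω/2)) f_s(x+εω,w) [φ(x,v′)+φ(x+εω,w′)−φ(x,v)−φ(x+εω,w)] dw dσ(ω) with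
v′ = v − ((v−w)·ω)ω, w′ = w + ((v−w)·ω)ω (sphereMeasure on S²; the kernel max((v−w)·ω,0) =
hardSphereKernel spelled inline); pre-collisional velocities on the trajectory are reflectVel (in
the separation direction) of the right-continuous post-collisional ones. The subtracted terms are
exactly the Hájek projection of the collision U-statistic computed with the Enskog model, so 𝓡_N =
degenerate remainder + conditional-mean chaos defect; the guard keeps Y(σ³ρ_s) on the analytic EOS
branch, so the late-time EOS-excursion content is excluded by the Statement's own packing guard
(D-0032; pre-D-0032 it lived in DiluteSelfConsistency). [deps: HsEosLowDensity] [difficulty: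
open-problem] (why it might fail: needs flux-weighted contact pair correlations → Y·product with
RELATIVE o(1) accuracy in time average along the true flow, and F¹_N(s) → f_s; rings/caging give
O(φ·Kn) dynamically (fine) but nothing rigorous controls non-equilibrium contact statistics of
deterministic spheres.) [PulvirentiSimonella2016, Bogolyubov1975, Hoeffding1963,
VanbeijerenErnst1973, Resibois1978, BGSSAnnals2023, Spohn1991]
#3 AdjointEnskogTestFamilyR (crux) — BACKWARD LINEARISED-ENSKOG TEST FAMILY, PACKING-GUARDED
(repaired K2; card crux 2, typed as approximate duality). For every EOS window η₁ > 0 on which f_ex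
= hsExcessFreeEnergy is real-analytic with f_ex′ > 0 (contact value Y = (3/2π)f_ex′ > 0) and
(ηZ(η))′ > 0 (isothermal stability, so the linearised / adjoint hs-Euler system is symmetrizable
hyperbolic): ∃σ₀ ∀σ<σ₀, for every classical hs-Euler solution on [0,T), every t ∈ (0,T) with packing
ρ_s(x)σ³ < η₁ on [0,t]×𝕋³, every smooth χ (Torus.IsSmooth) and constants a, e ∈ ℝ, b ∈ ℝ³: there is
an ADMISSIBLE family (c^N, κ^N) (same class as in CollisionResidualVanishes) with (i) terminal data
φ^N(t,x,v) = χ(x)(a + b·v + e|v|²/2) for every N; for all sufficiently large N (ii) C¹ along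
free-flight characteristics on [0,t] and (iii) defect |∂_r φ^N(r, x+(r−s)v, v)|_{r=s} +
L^N_sφ^N(s,x,v)| ≤ η_N(1+|v|²) on [0,t]×𝕋³×ℝ³ with η_N → 0; (iv) the hydrodynamic coefficient triple
at s = 0 converges uniformly on 𝕋³ to a continuous limit c₀ (the adjoint linearised hs-Euler flow of
the terminal data); (v) the Enskog defect of the Euler local Maxwellian tested on the family, Res_N
= ∫∫f_tφ^N_t − ∫∫f_0φ^N_0 − ∫₀ᵗ∫∫ f_s(Dφ^N_s + ½L^N_sφ^N_s), tends to 0 (hs-Euler with p = ρθZ(ρσ³)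
⇔ the collisional transfer at contact value Y: ½⟨f, L^N(β·v)⟩ → (2π/3)σ³∫Yρ²θ div β = ∫ρθ(Z−1) div
β, re-derived 2026-08-15 with sphereMeasure of mass 4π, Maxwellian variance θ, λ_N = Nε_N²). REPAIR
(2026-08-15): the refuted AdjointEnskogTestFamily had no tie of (ρ,u,θ) to the gas (constant state
at packing 1000 on the junk EOS branch ⇒ Y = 0, L^N ≡ 0) and asked (ii)–(iii) for every N (at N = 0,
λ_0 = 0 removes L^0 and the corrector, so free transport alone breaks the quadratic-in-v form for e
≠ 0 — false even under a guard); K2R carries the guard and the EOS window as hypotheses (discharged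
in DualityReductionInBand by the Statement's guard and HsEosLowDensity; pre-D-0032 in
DualityReduction by DiluteSelfConsistency) and is eventual in N. Construction foreseen: EXACT
backward solution of ∂_sφ + v·∇_xφ + L^N_sφ = 0 on [0,t] (zero defect, dissipative in reversed
time), split φ^N = P_sφ^N + κ^N/λ_N, the Hilbert expansion of the TEST function ψ + κ₁/λ + κ₂/λ²
(each κ_k of quadratic growth: the hard-sphere mean free path 1/λ_N is speed-independent)
controlling λ_N(1−P_s)φ^N in ⟨v⟩²-weighted sup norm, terminal layer of width 1/λ_N included. [deps:
HsEosLowDensity] [difficulty: L] (why it might fail: ⟨v⟩² is the borderline k = 2 weight of the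
L¹(⟨v⟩^k)/L^∞ duality for the linearised hard-sphere operator — energy conservation leaves no
Povzner margin, Gualdani–Mischler–Mouhot need k > 2 — so the stiff test-side Enskog semigroup around
an x-dependent local Maxwellian must stay bounded on ⟨v⟩²-growth uniformly in λ_N; not in print.)
[Caflisch1980, GuoJangJiang2009, Lachowicz1998, BGSR2017, Grad1963, arXiv:1006.5523]
#4 EquilibriumCollisionResidual (support since the 2026-08-15 retriage: at global equilibrium E
C_N[φ] = 0, ∫∫M·L^Nφ = 0 and E⟨μ_s,L^Nφ_s⟩ = 0 identically, so no constant is visible there; kept as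
a stepping stone) — GLOBAL-EQUILIBRIUM CASE OF THE COLLISION RESIDUAL. For constant profiles
(activity a, velocity u, temperature θ; Euler solution ≡ (1, u, θ)), σ < σ₀, every family of flows,
the equilibrium LLN at t = 0 as hypothesis, every t ≥ 0 and every admissible test family: ∫⁻
𝓡_N[φ^N]² d(Gibbs law) → 0. The law is flow-invariant (Liouville on the hard-sphere domain ×
Maxwellians of the conserved energy and momentum), so via the exact identity C_N[φ] = ⟨μ_t,φ_t⟩ −
⟨μ_0,φ_0⟩ − ∫⟨μ_s,Dφ_s⟩ (after mollifying φ at a scale N^(−1/2) ≪ δ_N ≪ N^(−1/3)) everything reduces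
to STATIC statements about the canonical hard-sphere gas on 𝕋³ at small packing: the one-body
density is uniform, the contact value of the pair correlation tends to Y(σ³) = (Z(σ³)−1)/((2π/3)σ³)
(virial theorem), and empirical averages have O(1/N) variances (cluster expansion). [deps:
CollisionResidualVanishes, HsEosLowDensity] [difficulty: L] (why it might fail: a factor-2 /
ordered-pair / λ_N = Nε² vs (N+1)ε² slip in 𝓡_N shows up here as a nonzero deterministic limit
½∫fLφ·(error); also needs the canonical contact value → virial Y(σ³), i.e. differentiability of the
limsup free energy (HsEosLowDensity, unproved in tree).) [Ruelle1969, LebowitzPenrose1964,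
VanbeijerenErnst1973, Hoeffding1963]
#9 HsEosLowDensity (support) — shared support (stmt-AtomisticToContinuum-0768): the hard-sphere
excess free energy is real-analytic on [0,η₀) with the canonical thermodynamic limit existing and
f_ex′(0) = 2π/3; makes Y and hsPressure smooth at small packing (used by K2's coefficients and K4's
contact value). [difficulty: L] [Ruelle1969, LebowitzPenrose1964]
#9 DualityReductionInBand (support, ADDED 2026-08-16 after the D-0032 re-type; provable-now — proved
in the planner's Sketch.lean,
farm rc 0, attached as evidence) — IN-BAND DUALITY GLUE TO THE STATEMENT: HsEosLowDensity → K1 → K2R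
→ HydrodynamicLimit (guarded
conjunct): η₀ := EOS window η₁ (eos_window); σ₀ := min(σ₀(smooth_core), 1/2); the Statement's guard
on [0,T) IS the `hguard` premise of the
landed smooth_core; t = 0 by tendsto_lintegral_sq_hydroCombo_zero, t > 0 by smooth_core +
combo_tendsto_of_pos (continuous χ, all
(a,b,e)); Chebyshev per field, momentum by coordinates — i.e. dualityReduction_proof minus the
DiluteSelfConsistency lines plus the
Chebyshev ending of AssemblyCore. [difficulty: provable-now] [PulvirentiSimonella2016, Spohn1991]
#9 DualityReduction (support, restated 2026-08-15; PROVED by dualityReduction_proof @ f0121d999c01,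
15 Theorems files; pre-D-0032
glue kept as record — it reaches the UNGUARDED waypoint and therefore needs DiluteSelfConsistency) —
HsEosLowDensity →
DiluteSelfConsistency → CollisionResidualVanishes → AdjointEnskogTestFamilyR → L2HydroFields: EOS
window η₁ (eos_window); σ₀ = min of the
σ₀'s of K1, K2R(η₁), DiluteSelfConsistency(η₁); t = 0 the hypothesis made L² (uniform integrability
from the Gaussian velocity marginal);
t > 0: guard on [0,t] from DiluteSelfConsistency, K2R's family for smooth χ, the exact pathwise
identity ⟨ν_t, χ·(a,b,e)⟩ = ⟨ν_0, φ^N_0⟩ +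
∫⟨ν_s, g_s⟩ds + 𝓡_N − Res_N on the good set of the flow (piecewise FTC along free flights + elastic
jumps), the four terms bounded in L² by
the t = 0 hypothesis, η_N × conserved energy, K1, K2R (v); smooth → continuous χ by the moment bound
(smooth_core, combo_tendsto_of_pos).
[difficulty: proved] [PulvirentiSimonella2016, Hoeffding1963, Spohn1991]
#9 DiluteSelfConsistency (support, shared stmt-AtomisticToContinuum-3091, owned by the
ImplosionLoophole line and wanted by most positive routes of the sub) — for every η > 0 and all
continuous positive profiles there is σ₀ such that for σ < σ₀ every data-tied classical hs-Euler
solution keeps ρ_t(x)σ³ < η on [0,T): the hidden PDE crux of every positive route (a σ-uniform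
density bound at the first singularity of 3-D compressible Euler; smooth implosion is the threat).
NOT load-bearing here since D-0032 (the Statement carries the guard; closes does not take it); kept
because the pre-D-0032 Assembly record names it. [difficulty: open-problem] [Sideris1985,
LukSpeck2024, BuckmasterCaolaboraGomezserrano2025]
#9 L2ToHydroLimit (support; pre-D-0032 record, proved for the unguarded conjunct — re-lands via
HydrodynamicLimit.of_unguarded; superseded in closes by DualityReductionInBand) — Chebyshev glue
with the ROOT-LEVEL conclusion (the sub-problem Statement decl `HydrodynamicLimit`, an abbrev of the
Literature constant; the proof attached to stmt-AtomisticToContinuum-0801 applies verbatim up to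
`show`): mean-square convergence of the fields implies convergence in probability, profile by
profile (meas_ge_le_lintegral_div, measurability from measurable_flow + continuity of χ).
[difficulty: provable-now] [OllaVaradhanYau1993, Spohn1991]

TWO-LAYER PLAN. Foreseen glued splits (none filed now): CollisionResidualVanishes ⇐ MeanChaosDefect
→ SelfAveraging → CollisionResidualVanishes, where
MeanChaosDefect = "if 𝓡_N[φ^N] concentrates around constants c_N then c_N → 0" (card crux 1: the
flux-weighted, time-averaged
conditional-MEAN chaos defect at contact relative to Y·f) and SelfAveraging = "∃ c_N with ∫⁻(𝓡_N −
c_N)² → 0" (card crux 3: summable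
decorrelation of pair residuals / macroscopic self-averaging of collision statistics).
AdjointEnskogTestFamilyR ⇐ AdjointHsEuler (smooth
backward solution of the adjoint linearised hs-Euler system with collisional-transfer terms,
terminal data χ·(a,b,c)) → KineticCorrector
(weighted-L^∞ inversion of the local test-side linearised operator on (1−P)-sources of cubic growth,
quadratic-growth output, Lipschitz in
(x,v)) → AdjointEnskogTestFamilyR (remainder/defect estimate for the stiff backward flow).
EquilibriumCollisionResidual ⇐ CanonicalContactValue
(static: canonical pair correlation at contact → Y(σ³), one-body density uniform, O(1/N) variances)
→ EquilibriumIdentity (mollified exact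
identity + invariance of the Gibbs law) → EquilibriumCollisionResidual.

KILL CRITERIA. ¬EquilibriumCollisionResidual with a NONZERO deterministic limit of 𝓡_N at
equilibrium refutes the bookkeeping (constants in L^N / the ½
centring): repairable once by `--restate` of K1/K4 with the corrected constant; a second failure
closes the route `refuted:CollisionResidualVanishes`.
¬CollisionResidualVanishes by an admissible family on which E𝓡_N has a nonzero limit at fixed σ
(e.g. an O(σ³) ring contribution to the
flux-weighted contact statistics that does not time-average away) closes the route outright
(`refuted:CollisionResidualVanishes`) and is a
typed negative for every Enskog-closure route (ChapmanEnskogCorrector C1, CollisionMeasureChaos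
CollisionRate, DenseKineticExpansion 0805).
¬AdjointEnskogTestFamilyR by an obstruction at LARGE N inside the EOS window (no admissible family
with quadratic velocity weight: the
stiff test-side semigroup leaks on ⟨v⟩²-growth, or Res_N has a nonzero limit exposing a constant
slip) forces a pivot: weight (1+|v|²)^(3/2)
in the defect plus a cubic-moment crux (shared with ChapmanEnskogCorrector's CubicMomentsInMean /
OneBodyEntropySqueeze's CubicMomentUI);
a refutation that again uses only finitely many N or a junk branch outside the guard is a
misstatement, repaired by restate, not a kill.
¬DiluteSelfConsistency (DenseExcursion by implosion tracking) no longer touches this route (D-0032: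
imploding solutions are outside the conjunct's scope); before, it broke this route together with
every packing-guarded route of the sub. L2HydroFields proved by
any other route moots this one (close `superseded`).

NOT DECOMPOSED YET. The mean/variance split of K1 (layer 2 above); the three PDE lemmas inside K2
(adjoint hs-Euler existence, corrector inversion with
hard-sphere growth rates, stiff remainder estimate); the static cluster-expansion lemmas inside K4;
the uniform-integrability lemma for
local Gibbs velocity marginals, the EOS-window lemma (done: EosWindow.lean) and the trajectory
identity inside DualityReduction (helper lemmas ride with `--supports DualityReduction`);
the card's DISJOINT-REGULARITY lemma (P1) and Boltzmann–Langevin reading (P2a) — negative knowledge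
explaining why no norm is taken; they are
proposed for the barrier catalogue (see Definition requests), not filed as items; any CLT-scale
statement (the card's (P2b) says centring at
Enskog fails at the CLT scale at fixed φ — deliberately out of scope: this route is LLN-scale only).

CHEAPEST FALSIFIER. Paper-and-pencil at GLOBAL EQUILIBRIUM with the pure momentum test function φ =
β(x)·v (κ = 0): compute lim E𝓡_N from the canonical contact
value and check it is 0, i.e. that ½∫f L^Nφ equals the mean collision functional with λ_N = Nε²,
ordered pairs and full increments as typed
(done here on paper: E C_N = ½E⟨μ,Lφ⟩ because each collision has two participants and conditioning
on one participant collects the FULL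
increment — consistent; a refuter should redo it independently, it costs an hour). Numerically (kit,
not available in plancard mode):
event-driven MD of N = 10⁴–10⁵ spheres at packing 0.05 in a shear-wave initial state, measure
𝓡_N[β·v] directly; predicted |𝓡_N| ≲ N^(−1/3). For K2R
specifically: GLOBAL EQUILIBRIUM with σ³L¹ dropped (stiff relaxation + transport on 𝕋³, constant
coefficients, one Fourier mode ξ in x): solve the
backward problem for the test-side operator λ_N L⁰ − iξ·v exactly from terminal data χ_ξ|v|²/2 and
check sup_s sup_v |λ_N(1−P)φ^N|/(1+|v|²) = O(|ξ|)
uniformly in λ_N (no log λ_N leak of the borderline weight) — a one-mode spectral computation /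
certified numerics (kit) that retires K2R if it fails.

NUMBERS. λ_N = Nε_N² = σ²N^(1/3)·(N/(N+1))^(2/3) collisions per particle per unit time up to the
factor π⟨|v−w|⟩ρY; ε_Nλ_N = σ³N/(N+1) (collisional
transfer O(σ³), survives); Kn ≍ 1/λ_N; hydrodynamic increments Δψ = O(ε_N‖∇ψ‖) so C_N[ψ] = O(σ³)
while C_N[κ]/λ_N = O(1); expected size of
the chaos defect in K1: relative O(φ_pack·Kn) (ring/shear correction to contact statistics, Lutsko
1996) → 0; card's count: incoherent part
sd ≍ N^(−1/3) on the hydrodynamic sector; Y(η) = 1 + (5π/12)η + O(η²), Z = 1 + (2π/3)ηY; freezing at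
packing ≈ 0.494 bounds σ₀. Items after
the 2026-08-15 repairs: 9 active (2 cruxes K1 = stmt-14658 (guarded restate, rev 8) / K2R =
stmt-11592, 1 target, 5 support incl. the shared HsEosLowDensity and DiluteSelfConsistency, 1
assembly) + the
refuted AdjointEnskogTestFamily kept as a negative edge. After the D-0032 repair (2026-08-16): 10
active (+ DualityReductionInBand); closes = K1, K2R, HsEosLowDensity (proved),
DualityReductionInBand (provable-now).

DEFINITION REQUESTS. None blocking (everything is inlined with `let`). Wanted for readability and
shared with CollisionMeasureChaos / DenseKineticExpansion 0805:
`enskogTestOperator` (the test-side linearised Enskog operator L^N above, topic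
Literature/Analysis/FluidPDE) and `empiricalCollisionSum`
(the finsum over collisionTimes ∩ (0,t] of ordered contact-pair increments of a HardSphereFlow
orbit) — to be filed by `ledger workitem add
--kind definition` once the route id exists. Barrier-catalogue proposal (operator/librarian):
DisjointRegularityEmpiricalEnskog — kernel (a)
tightness of √N(μ^N_0 − f_0) in Maxwellian-weighted H^(−s)(𝕋³×ℝ³) iff s > 3 (x-count: s > 3/2), (b)
the ω-averaged Enskog contact form is
bounded on H^σ_x × H^σ_x iff σ ≥ −1/2 (refuter-corrected), hence no translation-invariant Banach
scale makes the exact deviation equation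
(F) a locally Lipschitz ODE with O(1) data: Picard/Gronwall on the empirical Enskog equation is
supercritical at every λ_N ≥ c > 0.

Novelty: Searches (2026-08-15): `lit search --source crossref "Bodineau Gallagher Saint-Raymond hard sphere
dynamics Stokes Fourier L2"` (8: BGSR2017
doi:10.1007/s40818-016-0018-0, CRAS 2015 doi:10.1016/j.crma.2015.04.013, BGSS Annals 2023, BGSS CPAM
2023 doi:10.1002/cpa.22120, BGSR Invent.
2016); `lit search --source crossref "microscopic solutions Boltzmann-Enskog equation empirical
measure hard spheres Pulvirenti Simonella
Trushechkin"` (8: Bogolyubov1975, doi:10.3934/krm.2014.7.755, doi:10.3934/krm.2018036,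
PulvirentiSimonella2016 doi:10.1007/s00222-016-0682-4);
`lit search --source zbmath "Enskog equation hydrodynamic limit Euler"` (15: Lachowicz1988
doi:10.1007/bf00251460, Lachowicz1998
doi:10.2977/prims/1195144692, Golse–Saint-Raymond survey zbl:1109.35112); `lit search --source
zbmath "Enskog equation fluctuations central
limit theorem hard spheres"` (0); `lit search --source s2 "Enskog equation positive density hard
spheres rigorous derivation hydrodynamics
fluctuation fixed packing fraction" --year-from 2015` (1, irrelevant); `lit frontier
AtomisticToContinuum --since 2021` (30 rows: DHM
descendants arXiv:2602.04407, stochastic binary-collision fluctuations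
doi:10.1007/s10955-026-03570-w, nothing at fixed density by duality);
`lit galaxy search "linearized Enskog equation" --star all` (2 book hits on transport coefficients,
no mathematics); local `lit search
--hybrid` and OpenAlex/arXiv tiers unavailable this session (rc 75 / HTTP 429); grep of all 40 route
files of the sub-  [refs: 10.1007/s40818-016-0018-0, 10.1016/j.crma.2015.04.013, 10.1002/cpa.22120, 10.3934/krm.2014.7.755, 10.3934/krm.2018036, 10.1007/s00222-016-0682-4, 10.1007/bf00251460, 10.2977/prims/1195144692, 10.1007/s10955-026-03570-w, 2602.04407, 2004.00311, 1511.03057, doi:10.1007/s40818-016-0018-0, doi:10.1016/j.crma.2015.04.013, doi:10.1002/cpa.22120, doi:10.3934/krm.2014.7.755, doi:10.3934/krm.2018036, doi:1]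

Barriers (technique_class: duality, linearised-kinetic-adjoint, u-statistic): - technique_class: duality, linearised-kinetic-adjoint, u-statistic
- Literature.Barriers.AtomisticToContinuum.DiluteRegimeBarrier: evaded — no Boltzmann–Grad limit and
no Boltzmann equation for f^(1); (N+1)ε³ = σ³ is fixed, the Enskog shifts and Y(σ³ρ) sit inside L^N,
and the excess pressure ρθ(Z−1) is produced by the collisional transfer λ_Nε_N = σ³ (K2 (v)), so the
ideal-gas trap (kernel (a)) cannot occur; the Hilbert expansion here is of the TEST function against
the hs-EOS, outside the narrowed technique class (Boltzmann sub-family).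
- Literature.Barriers.AtomisticToContinuum.NoDensityExpansionBarrier: not met — nothing is expanded
in density and no transport coefficient appears (Euler scale, LLN); its ring physics is exactly "why
K1 might fail" and is bet to be relative O(φ·Kn) after flux weighting and time averaging, never
summed.
- Literature.Barriers.AtomisticToContinuum.BoltzmannHypothesisBarrier: outside its technique class —
no relative entropy, no classification of stationary states, no one-block replacement; local
equilibrium enters only through the explicit Euler local Maxwellian inside L^N and is TESTED (K1),
not assumed; on the barrier's kernels (ideal gas: L^N ≡ 0, 𝓡_N ≡ 0) K1 is vacuous and K2 (v) fails
exactly as Euler does — consistent.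
- Literature.Barriers.AtomisticToContinuum.HighMomentumCutoffBarrier: sidestepped — the only
velocity weight ever paired with μ^N_s is (1+|v|²), controlled by EXACT energy conservation; the
price is paid inside K2 (quadrat

History (route lifecycle, newest last):
- 2026-08-15T18:25:32Z · rev 4: restated DualityReduction (stmt-AtomisticToContinuum-9170), Assembly (stmt-AtomisticToContinuum-9172) — repair: AdjointEnskogTestFamily (stmt-AtomisticToContinuum-9168) refuted-misstated by Summit.AtomisticToContinuum.HydrodynamicLimit.Theorems.EnskogAdjointDualit (planner-rfix-AtomisticToContinuum-EnskogAdjo-53553cdd-0)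
- 2026-08-15T18:27:25Z · rev 5: dropped AdjointEnskogTestFamily — repair: AdjointEnskogTestFamily (stmt-AtomisticToContinuum-9168) is refuted-misstated and no longer load-bearing — superseded by AdjointEnskogTestFamilyR (stmt- (planner-rfix-AtomisticToContinuum-EnskogAdjo-53553cdd-0)
- 2026-08-15T18:27:25Z · REPAIRED (drop AdjointEnskogTestFamily) — back to open: repair: AdjointEnskogTestFamily (stmt-AtomisticToContinuum-9168) is refuted-misstated and no longer load-bearing — superseded by AdjointEnskogTestFamilyR (stmt- (planner-rfix-AtomisticToContinuum-EnskogAdjo-53553cdd-0)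
- 2026-08-15T19:10:35Z · rev 8: restated CollisionResidualVanishes (stmt-AtomisticToContinuum-9167) — repair (route-repair g3; refuter advice rreview-0815T13-12-0 / a38272b2 on stmt-9167): K1 CollisionResidualVanishes restated 1:1 (same name/kind/rank) = old sta (planner-rrepair-AtomisticToContinuum-EnskogAdj-53553cdd-g3-0)
- 2026-08-16T23:55:16Z · rev 13: restated Assembly (stmt-AtomisticToContinuum-11591) — route-repair follow-up (rbadge 53553cdd): RESTATE the stale pre-D-0032 Assembly (stmt-11591: K1 → K2R → HsEosLowDensity → DiluteSelfConsistency → HydrodynamicLi (planner-rbadge-AtomisticToContinuum-EnskogAdjo-53553cdd-0)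
- 2026-08-16T23:55:16Z · rev 13: dropped DiluteSelfConsistency — route-repair follow-up (rbadge 53553cdd): RESTATE the stale pre-D-0032 Assembly (stmt-11591: K1 → K2R → HsEosLowDensity → DiluteSelfConsistency → HydrodynamicLi (planner-rbadge-AtomisticToContinuum-EnskogAdjo-53553cdd-0)
- 2026-08-17T17:11:16Z · BROKEN — AdjointEnskogTestFamilyR (stmt-AtomisticToContinuum-11592, crux) refuted by Summit.AtomisticToContinuum.HydrodynamicLimit.Theorems.EnskogAdjointDuality.not_AdjointEnskogTestFamilyR @ a145e56290bf (prover-line-stmt-AtomisticToContinuum-11592-c5-0)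
- 2026-08-20T17:13:57Z · CLOSED refuted — refuted:stmt-AtomisticToContinuum-11592 (AdjointEnskogTestFamilyR) by Summit.AtomisticToContinuum.HydrodynamicLimit.Theorems.EnskogAdjointDuality.not_AdjointEnskogTestFamilyR (grace expired, auto-close) (gate)

sub-problem: HydrodynamicLimit · status: closed(refuted) · opened planner-plancard-AtomisticToContinuum-Hydrody-3dc92b24-0 2026-08-15T13:51:40Z · rev 13 · ledger route-AtomisticToContinuum-EnskogAdjointDuality
GENERATED by the gate from the ledger (D-0016/17). Provers cite these decls: `theorem foo : Summit.AtomisticToContinuum.HydrodynamicLimit.Theses.EnskogAdjointDuality.<Decl> := …` in Summits/AtomisticToContinuum/HydrodynamicLimit/Theorems/<Name>.lean.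
-/

namespace Summit.AtomisticToContinuum.HydrodynamicLimit.Theses.EnskogAdjointDuality

open scoped BigOperators Topology Manifold Classical MeasureTheory ProbabilityTheory Matrix InnerProductSpace ComplexConjugate ContinuousMap
open Filter Set Function TopologicalSpace MeasureTheory

attribute [summit_statement] _root_.HydrodynamicLimit

/-- item stmt-AtomisticToContinuum-9057 · target · rank 0 · open · by planner
why it might fail: In substance the open conjunct itself (L² ⇔ in probability here: fields are sup|χ|·(1,|v|,|v|²)-bounded, energy is conserved, t=0 tails Gaussian); deterministic spheres at fixed σ may fail to keep local equilibrium on Euler times (Spohn1991 I.3) — nothing is known without noise (OVY1993).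
sources: Spohn1991, OllaVaradhanYau1993
[support] SHARED TYPED WAYPOINT (item stmt-AtomisticToContinuum-0800 verbatim; target of routes
DenseKineticExpansion, DissipativeWeakStrong, OneParticleInfluence): mean-square convergence of the
three empirical fields at every t < T under the local Gibbs law; here the codomain of
PayloadClosure. [difficulty: open-problem] -/
@[route_item "route-AtomisticToContinuum-EnskogAdjointDuality"]
def L2HydroFields : Prop :=
  ∀ (a₀ θ₀ : Literature.MathematicalPhysics.KineticTheory.T3 → ℝ) (u₀ : Literature.MathematicalPhysics.KineticTheory.T3 → Literature.MathematicalPhysics.KineticTheory.V3), Continuous a₀ → Continuous θ₀ → Continuous u₀ → (∀ x, 0 < a₀ x) → (∀ x, 0 < θ₀ x) → ∃ σ₀ : ℝ, 0 < σ₀ ∧ ∀ σ : ℝ, 0 < σ → σ < σ₀ → ∀ (T : ℝ) (ρ θ : ℝ → Literature.MathematicalPhysics.KineticTheory.T3 → ℝ) (u : ℝ → Literature.MathematicalPhysics.KineticTheory.T3 → Literature.MathematicalPhysics.KineticTheory.V3), Literature.MathematicalPhysics.KineticTheory.IsHardSphereEulerSolution σ T ρ u θ → ∀ Φ : (N : ℕ)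 → Literature.Analysis.FluidPDE.HardSphereFlow (Literature.Analysis.FluidPDE.Torus.geometry (Fin 3)) (Literature.MathematicalPhysics.KineticTheory.hsDiameter σ N) (N + 1), Literature.MathematicalPhysics.KineticTheory.TendstoHydroFieldsAt (fun N => Literature.MathematicalPhysics.KineticTheory.localGibbsLaw σ a₀ u₀ θ₀ N (Φ N)) Φ ρ u θ 0 → ∀ t ∈ Set.Ico 0 T, ∀ χ : Literature.MathematicalPhysics.KineticTheory.T3 → ℝ, Continuous χ → Filter.Tendsto (fun N : ℕ => ∫⁻ z, ENNReal.ofReal (|Literature.MathematicalPhysics.KineticTheory.empiricalDensityField ((Φ N).flow t z) χ - ∫ x, χ x * ρ t x| ^ 2) ∂(Literature.MathematicalPhysics.KineticTheory.localGibbsLaw σ a₀ u₀ θ₀ N (Φ N))) Filter.atTop (nhds 0) ∧ Filter.Tendsto (fun N : ℕ => ∫⁻ z, ENNReal.ofReal (‖Literature.MathematicalPhysics.KineticTheory.empiricalMomentumField ((Φ N).flow t z) χ - ∫ x, (χ x * ρ t x) • u t x‖ ^ 2) ∂(Literature.MathematicalPhysics.KineticTheory.localGibbsLaw σ a₀ u₀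 θ₀ N (Φ N))) Filter.atTop (nhds 0) ∧ Filter.Tendsto (fun N : ℕ => ∫⁻ z, ENNReal.ofReal (|Literature.MathematicalPhysics.KineticTheory.empiricalEnergyField ((Φ N).flow t z) χ - ∫ x, χ x * Literature.MathematicalPhysics.KineticTheory.totalEnergyDensity (ρ t x) (u t x) (θ t x)| ^ 2) ∂(Literature.MathematicalPhysics.KineticTheory.localGibbsLaw σ a₀ u₀ θ₀ N (Φ N))) Filter.atTop (nhds 0)

-- earlier CollisionResidualVanishes (stmt-AtomisticToContinuum-9167, replaced 2026-08-15T19:10:35Z -> stmt-AtomisticToContinuum-14658): retired by None — ∀ (a₀ θ₀ : UnitAddTorus (Fin 3) → ℝ) (u₀ : UnitAddTorus (Fin 3) → EuclideanSpace ℝ (Fin 3)), Continuous a₀ → Continuous θ₀ → Continuous u₀ → (∀ x, 0 < a₀ x) → (∀ x, 0 < θ₀ x) → ∃ σ₀ : ℝ, 0 < σ₀ ∧ ∀ σ : ℝ, 0 < σ → σ < σ₀ → ∀ (T : ℝ) (ρ θ : ℝ → UnitA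
/-- item stmt-AtomisticToContinuum-14658 · crux · rank 2 · closed · moot by None · by planner
why it might fail: Needs contact statistics of deterministic spheres at fixed σ → Y·f⊗f with relative o(1) accuracy in time-averaged conditional mean (no positive-density Lanford theorem: local-equilibrium propagation in substance) plus an L² LLN for ⟨μ_s,L_sφ_s⟩ whose |v|³ weight energy conservation cannot bound.
sources: PulvirentiSimonella2016, PulvirentiSimonellaTrushechkin2018, Bogolyubov1975, Hoeffding1963, VanbeijerenErnst1973, Resibois1978
[crux] COLLISION RESIDUAL → 0 IN MEAN SQUARE, PACKING-GUARDED (2026-08-15 restate of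
stmt-AtomisticToContinuum-9167 on the route-review refuters' advice: the statement is verbatim the
old one plus K2R's EOS-window prefix and the packing guard ρ_s(x)σ³ < η₁ on [0,t]×𝕋³, both
discharged inside DualityReduction by HsEosLowDensity (EosWindow) and DiluteSelfConsistency exactly
as for K2R — so the late-time EOS-excursion exposure (Y(σ³ρ_s) evaluated outside the analytic
branch, where the tree's f_ex is junk) now lives only in DiluteSelfConsistency and this crux can
fail for one reason only). For every EOS window η₁ > 0 on which f_ex = hsExcessFreeEnergy is
real-analytic with f_ex′ > 0 and (ηZ(η))′ > 0: for continuous positive profiles ∃σ₀ ∀σ<σ₀, for every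
classical hs-Euler solution (ρ,u,θ) on [0,T) matched to the data by the t = 0 LLN hypothesis, every
family of hard-sphere flows, every t ∈ [0,T) with ρ_s(x)σ³ < η₁ for all s ∈ [0,t] and x, and EVERY
admissible test family φ^N(s,x,v) = α^N(s,x) + β^N(s,x)·v + γ^N(s,x)|v|²/2 + κ^N(s,x,v)/λ_N (c^N =
(α^N,β^N,γ^N) jointly continuous, sup-bounded and uniformly Lipschitz in x for the torus metric; κ^N
continuous with |κ^N| ≤ C(1+|v|²) and |κ^ -/
@[route_item "route-AtomisticToContinuum-EnskogAdjointDuality", crux]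
def CollisionResidualVanishes : Prop :=
  ∀ η₁ : ℝ, 0 < η₁ → AnalyticOnNhd ℝ Literature.MathematicalPhysics.KineticTheory.hsExcessFreeEnergy (Set.Ioo 0 η₁) → (∀ η ∈ Set.Ioo 0 η₁, 0 < deriv Literature.MathematicalPhysics.KineticTheory.hsExcessFreeEnergy η) → (∀ η ∈ Set.Ioo 0 η₁, 0 < deriv (fun x : ℝ => x * Literature.MathematicalPhysics.KineticTheory.hsCompressibility x) η) → ∀ (a₀ θ₀ : UnitAddTorus (Fin 3) → ℝ) (u₀ : UnitAddTorus (Fin 3) → EuclideanSpace ℝ (Fin 3)), Continuous a₀ → Continuous θ₀ → Continuous u₀ → (∀ x, 0 < a₀ x) → (∀ x, 0 < θ₀ x) → ∃ σ₀ : ℝ, 0 < σ₀ ∧ ∀ σ : ℝ, 0 < σ → σ < σ₀ → ∀ (T : ℝ) (ρ θ : ℝ → UnitAddTorus (Fin 3) → ℝ) (u : ℝ → UnitAddTorus (Fin 3) → EuclideanSpace ℝ (Fin 3)), Literature.MathematicalPhysics.KineticTheory.IsHardSphereEulerSolution σ T ρ u θ → ∀ Φ : (N : ℕ) → Literature.Analysis.FluidPDE.HardSphereFlow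 (Literature.Analysis.FluidPDE.Torus.geometry (Fin 3)) (Literature.MathematicalPhysics.KineticTheory.hsDiameter σ N) (N + 1), Literature.MathematicalPhysics.KineticTheory.TendstoHydroFieldsAt (fun N => Literature.MathematicalPhysics.KineticTheory.localGibbsLaw σ a₀ u₀ θ₀ N (Φ N)) Φ ρ u θ 0 → ∀ t ∈ Set.Ico 0 T, (∀ s ∈ Set.Icc 0 t, ∀ x, ρ s x * σ ^ 3 < η₁) → ∀ (c : ℕ → ℝ → UnitAddTorus (Fin 3) → ℝ × EuclideanSpace ℝ (Fin 3) × ℝ) (κ : ℕ → ℝ → UnitAddTorus (Fin 3) → EuclideanSpace ℝ (Fin 3) → ℝ), (∀ N, Continuous (Function.uncurry (c N))) → (∀ N, Continuous (fun p : ℝ × UnitAddTorus (Fin 3) × EuclideanSpace ℝ (Fin 3) => κ N p.1 p.2.1 p.2.2)) → (∃ C : ℝ, ∀ N s x x' v v', ‖c N s x‖ ≤ C ∧ dist (c N s x) (c N s x') ≤ C * dist x x' ∧ |κ N s x v| ≤ C * (1 + ‖v‖ ^ 2) ∧ |κ N s x v - κ N s x' v'| ≤ C * (1 + ‖v‖ ^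 2 + ‖v'‖ ^ 2) * (dist x x' + ‖v - v'‖)) → let G := Literature.Analysis.FluidPDE.Torus.geometry (Fin 3); let ε := fun N : ℕ => Literature.MathematicalPhysics.KineticTheory.hsDiameter σ N; let lam := fun N : ℕ => (N : ℝ) * ε N ^ 2; let f := fun (s : ℝ) (x : UnitAddTorus (Fin 3)) (v : EuclideanSpace ℝ (Fin 3)) => ρ s x * Literature.Analysis.FluidPDE.localMaxwellian 1 (θ s x) (u s x) v; let Y := fun η : ℝ => 3 / (2 * Real.pi) * deriv Literature.MathematicalPhysics.KineticTheory.hsExcessFreeEnergy η; let φ := fun (N : ℕ) (s : ℝ) (x : UnitAddTorus (Fin 3)) (v : EuclideanSpace ℝ (Fin 3)) => (c N s x).1 + inner ℝ (c N s x).2.1 v + (c N s x).2.2 * ‖v‖ ^ 2 / 2 + (lam N)⁻¹ * κ N s x v; let L := fun (N : ℕ) (s : ℝ) (x : UnitAddTorus (Fin 3)) (v : EuclideanSpace ℝ (Fin 3)) => lam N * ∫ ω : Metric.sphere (0 : EuclideanSpace ℝ (Fin 3)) 1, (let y := G.translate x (ε N • (ω : EuclideanSpace ℝ (Fin 3)));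 ∫ w : EuclideanSpace ℝ (Fin 3), max (inner ℝ (v - w) ω) 0 * Y (σ ^ 3 * ρ s (G.translate x ((ε N / 2) • (ω : EuclideanSpace ℝ (Fin 3))))) * f s y w * (φ N s x (v - inner ℝ (v - w) ω • (ω : EuclideanSpace ℝ (Fin 3))) + φ N s y (w + inner ℝ (v - w) ω • (ω : EuclideanSpace ℝ (Fin 3))) - φ N s x v - φ N s y w)) ∂Literature.MathematicalPhysics.KineticTheory.sphereMeasure; let R := fun (N : ℕ) (z : Literature.Analysis.FluidPDE.Config (N + 1) (Fin 3) (UnitAddTorus (Fin 3))) => (let q := fun r : ℝ => (Φ N).flow r z; (N + 1 : ℝ)⁻¹ * (∑ᶠ (s : ℝ) (_ : s ∈ Literature.Analysis.FluidPDE.collisionTimes G (ε N) q ∩ Set.Ioc 0 t), ∑ i, ∑ j, (if i ≠ j ∧ ‖G.sepVec (q s i).1 (q s j).1‖ = ε N then φ N s (q s i).1 (q s i).2 - φ N s (q s i).1 (Literature.Analysis.FluidPDE.reflectVel (G.sepVec (q s i).1 (q s j).1) ((q s i).2, (q s j).2)).1 else 0)) - (∫ s in Set.Icc 0 t, ∫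 y, L N s y.1 y.2 ∂(Literature.Analysis.FluidPDE.empiricalMeasure (q s))) + (1 / 2 : ℝ) * ∫ s in Set.Icc 0 t, ∫ x : UnitAddTorus (Fin 3), ∫ v : EuclideanSpace ℝ (Fin 3), f s x v * L N s x v); Filter.Tendsto (fun N : ℕ => ∫⁻ z, ENNReal.ofReal (R N z ^ 2) ∂(Literature.MathematicalPhysics.KineticTheory.localGibbsLaw σ a₀ u₀ θ₀ N (Φ N))) Filter.atTop (nhds 0)

/-- item stmt-AtomisticToContinuum-11592 · crux · rank 3 · closed · refuted by Summit.AtomisticToContinuum.HydrodynamicLimit.Theorems.EnskogAdjointDuality.not_AdjointEnskogTestFamilyR @ a145e56290bf (prover) · by planner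
why it might fail: ⟨v⟩² is the borderline k=2 weight (energy conservation leaves no Povzner margin; GualdaniMischlerMouhot2017 need k>2): the stiff test-side linearised Enskog semigroup around an x-dependent local Maxwellian must stay bounded on ⟨v⟩²-growth uniformly in λ_N, with a 1/λ_N terminal layer — not in print.
sources: Caflisch1980, GuoJangJiang2009, Lachowicz1998, BGSR2017, Grad1963, GualdaniMischlerMouhot2017
[crux] BACKWARD LINEARISED-ENSKOG TEST FAMILY, PACKING-GUARDED (repair of the refuted
AdjointEnskogTestFamily = stmt-AtomisticToContinuum-9168; card crux 2, typed as approximate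
duality). For every EOS window η₁ > 0 on which f_ex = hsExcessFreeEnergy is real-analytic with f_ex′
> 0 (contact value Y = (3/2π)f_ex′ > 0) and (ηZ(η))′ > 0 (isothermal stability ⇒
symmetrizable-hyperbolic adjoint hs-Euler): ∃σ₀ ∀σ<σ₀, for every classical hs-Euler solution on
[0,T), every t ∈ (0,T) with packing ρ_s(x)σ³ < η₁ on [0,t]×𝕋³, every smooth χ and constants a, e, b:
there is an ADMISSIBLE family (c^N, κ^N) (same class as in CollisionResidualVanishes: c^N jointly
continuous, sup-bounded, uniformly Lipschitz in x; κ^N continuous, |κ^N| ≤ C(1+|v|²),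
weighted-Lipschitz in (x,v); one C) with (i) terminal data φ^N(t,x,v) = χ(x)(a + b·v + e|v|²/2) for
every N; for all sufficiently large N (ii) C¹ along free-flight characteristics on [0,t] and (iii)
defect |∂_r φ^N(r, x+(r−s)v, v)|_{r=s} + L^N_sφ^N(s,x,v)| ≤ η_N(1+|v|²) with η_N → 0; (iv) c^N(0,·)
→ c₀ uniformly, c₀ continuous (adjoint linearised hs-Euler flow of the terminal data); (v) the
Enskog defect of the Euler local Maxwellian tested on the family, -/
@[route_item "route-AtomisticToContinuum-EnskogAdjointDuality", crux]
def AdjointEnskogTestFamilyR : Prop :=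
  ∀ η₁ : ℝ, 0 < η₁ → AnalyticOnNhd ℝ Literature.MathematicalPhysics.KineticTheory.hsExcessFreeEnergy (Set.Ioo 0 η₁) → (∀ η ∈ Set.Ioo 0 η₁, 0 < deriv Literature.MathematicalPhysics.KineticTheory.hsExcessFreeEnergy η) → (∀ η ∈ Set.Ioo 0 η₁, 0 < deriv (fun x : ℝ => x * Literature.MathematicalPhysics.KineticTheory.hsCompressibility x) η) → ∃ σ₀ : ℝ, 0 < σ₀ ∧ ∀ σ : ℝ, 0 < σ → σ < σ₀ → ∀ (T : ℝ) (ρ θ : ℝ → UnitAddTorus (Fin 3) → ℝ) (u : ℝ → UnitAddTorus (Fin 3) → EuclideanSpace ℝ (Fin 3)), Literature.MathematicalPhysics.KineticTheory.IsHardSphereEulerSolution σ T ρ u θ → ∀ t ∈ Set.Ioo 0 T, (∀ s ∈ Set.Icc 0 t, ∀ x, ρ s x * σ ^ 3 < η₁) → ∀ χ : UnitAddTorus (Fin 3) → ℝ, Literature.Analysis.FunctionSpaces.Torus.IsSmooth χ → ∀ (a e : ℝ) (b : EuclideanSpace ℝ (Fin 3)), ∃ (c : ℕ → ℝ → UnitAddTorus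 (Fin 3) → ℝ × EuclideanSpace ℝ (Fin 3) × ℝ) (κ : ℕ → ℝ → UnitAddTorus (Fin 3) → EuclideanSpace ℝ (Fin 3) → ℝ), (∀ N, Continuous (Function.uncurry (c N))) ∧ (∀ N, Continuous (fun p : ℝ × UnitAddTorus (Fin 3) × EuclideanSpace ℝ (Fin 3) => κ N p.1 p.2.1 p.2.2)) ∧ (∃ C : ℝ, ∀ N s x x' v v', ‖c N s x‖ ≤ C ∧ dist (c N s x) (c N s x') ≤ C * dist x x' ∧ |κ N s x v| ≤ C * (1 + ‖v‖ ^ 2) ∧ |κ N s x v - κ N s x' v'| ≤ C * (1 + ‖v‖ ^ 2 + ‖v'‖ ^ 2) * (dist x x' + ‖v - v'‖)) ∧ (let G := Literature.Analysis.FluidPDE.Torus.geometry (Fin 3); let ε := fun N : ℕ => Literature.MathematicalPhysics.KineticTheory.hsDiameter σ N; let lam := fun N : ℕ => (N : ℝ) * ε N ^ 2; let f := fun (s : ℝ) (x : UnitAddTorus (Fin 3)) (v : EuclideanSpace ℝ (Fin 3)) => ρ s x * Literature.Analysis.FluidPDE.localMaxwellian 1 (θ s x) (u s x) v; let Y :=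 fun η : ℝ => 3 / (2 * Real.pi) * deriv Literature.MathematicalPhysics.KineticTheory.hsExcessFreeEnergy η; let φ := fun (N : ℕ) (s : ℝ) (x : UnitAddTorus (Fin 3)) (v : EuclideanSpace ℝ (Fin 3)) => (c N s x).1 + inner ℝ (c N s x).2.1 v + (c N s x).2.2 * ‖v‖ ^ 2 / 2 + (lam N)⁻¹ * κ N s x v; let L := fun (N : ℕ) (s : ℝ) (x : UnitAddTorus (Fin 3)) (v : EuclideanSpace ℝ (Fin 3)) => lam N * ∫ ω : Metric.sphere (0 : EuclideanSpace ℝ (Fin 3)) 1, (let y := G.translate x (ε N • (ω : EuclideanSpace ℝ (Fin 3))); ∫ w : EuclideanSpace ℝ (Fin 3), max (inner ℝ (v - w) ω) 0 * Y (σ ^ 3 * ρ s (G.translate x ((ε N / 2) • (ω : EuclideanSpace ℝ (Fin 3))))) * f s y w * (φ N s x (v - inner ℝ (v - w) ω • (ω : EuclideanSpace ℝ (Fin 3))) + φ N s y (w + inner ℝ (v - w) ω • (ω : EuclideanSpace ℝ (Fin 3))) - φ N s x v - φ N s y w)) ∂Literature.MathematicalPhysics.KineticTheory.sphereMeasure;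 (∀ N x v, φ N t x v = χ x * (a + inner ℝ b v + e * ‖v‖ ^ 2 / 2)) ∧ (∃ η : ℕ → ℝ, Filter.Tendsto η Filter.atTop (nhds 0) ∧ ∀ᶠ N in Filter.atTop, (∀ x v, ContDiffOn ℝ 1 (fun r => φ N r (G.translate x (r • v)) v) (Set.Icc 0 t)) ∧ (∀ s ∈ Set.Icc 0 t, ∀ x v, |derivWithin (fun r => φ N r (G.translate x ((r - s) • v)) v) (Set.Icc 0 t) s + L N s x v| ≤ η N * (1 + ‖v‖ ^ 2))) ∧ (∃ c₀ : UnitAddTorus (Fin 3) → ℝ × EuclideanSpace ℝ (Fin 3) × ℝ, Continuous c₀ ∧ ∀ δ : ℝ, 0 < δ → ∀ᶠ N in Filter.atTop, ∀ x, dist (c N 0 x) (c₀ x) ≤ δ) ∧ Filter.Tendsto (fun N : ℕ => (∫ x : UnitAddTorus (Fin 3), ∫ v : EuclideanSpace ℝ (Fin 3), f t x v * φ N t x v) - (∫ x : UnitAddTorus (Fin 3), ∫ v : EuclideanSpace ℝ (Fin 3), f 0 x v * φ N 0 x v) - ∫ s in Set.Icc 0 t, ∫ x : UnitAddTorus (Fin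 3), ∫ v : EuclideanSpace ℝ (Fin 3), f s x v * (derivWithin (fun r => φ N r (G.translate x ((r - s) • v)) v) (Set.Icc 0 t) s + (1 / 2 : ℝ) * L N s x v)) Filter.atTop (nhds 0))

/-- item stmt-AtomisticToContinuum-9169 · support · rank 4 · closed · moot by None · by planner
why it might fail: a factor-2 / ordered-pair / λ_N = Nε² vs (N+1)ε² slip in 𝓡_N shows up here as a nonzero deterministic limit ½∫fLφ·(error); also needs the canonical contact value → virial Y(σ³), i.e. differentiability of the limsup free energy (HsEosLowDensity, unproved in tree).
sources: Spohn1991, Hoeffding1963, GST2013, Simanyi2013, BGSSCPAM2023, PulvirentiTsagkarogiannis2012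
[crux] GLOBAL-EQUILIBRIUM CASE OF THE COLLISION RESIDUAL (checks every constant of the bookkeeping
against statics). For constant profiles (activity a, velocity u, temperature θ; Euler solution ≡ (1,
u, θ)), σ < σ₀, every family of flows, the equilibrium LLN at t = 0 as hypothesis, every t ≥ 0 and
every admissible test family: ∫⁻ 𝓡_N[φ^N]² d(Gibbs law) → 0. The law is flow-invariant (Liouville on
the hard-sphere domain × Maxwellians of the conserved energy and momentum), so via the exact
identity C_N[φ] = ⟨μ_t,φ_t⟩ − ⟨μ_0,φ_0⟩ − ∫⟨μ_s,Dφ_s⟩ (after mollifying φ at a scale N^(−1/2) ≪ δ_N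
≪ N^(−1/3)) everything reduces to STATIC statements about the canonical hard-sphere gas on 𝕋³ at
small packing: the one-body density is uniform, the contact value of the pair correlation tends to
Y(σ³) = (Z(σ³)−1)/((2π/3)σ³) (virial theorem), and empirical averages have O(1/N) variances (cluster
expansion). [deps: CollisionResidualVanishes, HsEosLowDensity] [difficulty: L] -/
@[route_item "route-AtomisticToContinuum-EnskogAdjointDuality"]
def EquilibriumCollisionResidual : Prop :=
  ∀ (a th : ℝ) (uu : EuclideanSpace ℝ (Fin 3)), 0 < a → 0 < th → ∃ σ₀ : ℝ, 0 < σ₀ ∧ ∀ σ : ℝ, 0 < σ → σ < σ₀ → ∀ Φ : (N : ℕ) → Literature.Analysis.FluidPDE.HardSphereFlow (Literature.Analysis.FluidPDE.Torus.geometry (Fin 3)) (Literature.MathematicalPhysics.KineticTheory.hsDiameter σ N) (N + 1), Literature.MathematicalPhysics.KineticTheory.TendstoHydroFieldsAt (fun N => Literature.MathematicalPhysics.KineticTheory.localGibbsLaw σ (fun _ => a) (fun _ => uu) (fun _ => th) N (Φ N)) Φ (fun _ _ => 1) (fun _ _ => uu) (fun _ _ => th) 0 → ∀ t : ℝ, 0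 ≤ t → ∀ (c : ℕ → ℝ → UnitAddTorus (Fin 3) → ℝ × EuclideanSpace ℝ (Fin 3) × ℝ) (κ : ℕ → ℝ → UnitAddTorus (Fin 3) → EuclideanSpace ℝ (Fin 3) → ℝ), (∀ N, Continuous (Function.uncurry (c N))) → (∀ N, Continuous (fun p : ℝ × UnitAddTorus (Fin 3) × EuclideanSpace ℝ (Fin 3) => κ N p.1 p.2.1 p.2.2)) → (∃ C : ℝ, ∀ N s x x' v v', ‖c N s x‖ ≤ C ∧ dist (c N s x) (c N s x') ≤ C * dist x x' ∧ |κ N s x v| ≤ C * (1 + ‖v‖ ^ 2) ∧ |κ N s x v - κ N s x' v'| ≤ C * (1 + ‖v‖ ^ 2 + ‖v'‖ ^ 2) * (dist x x' + ‖v - v'‖)) → let ρ := fun (_ : ℝ) (_ : UnitAddTorus (Fin 3)) => (1 : ℝ); let u := fun (_ : ℝ) (_ : UnitAddTorus (Fin 3)) => uu; let θ := fun (_ : ℝ) (_ : UnitAddTorus (Fin 3)) => th; let G := Literature.Analysis.FluidPDE.Torus.geometry (Fin 3); let ε := fun N : ℕ => Literature.MathematicalPhysics.KineticTheory.hsDiameter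 σ N; let lam := fun N : ℕ => (N : ℝ) * ε N ^ 2; let f := fun (s : ℝ) (x : UnitAddTorus (Fin 3)) (v : EuclideanSpace ℝ (Fin 3)) => ρ s x * Literature.Analysis.FluidPDE.localMaxwellian 1 (θ s x) (u s x) v; let Y := fun η : ℝ => 3 / (2 * Real.pi) * deriv Literature.MathematicalPhysics.KineticTheory.hsExcessFreeEnergy η; let φ := fun (N : ℕ) (s : ℝ) (x : UnitAddTorus (Fin 3)) (v : EuclideanSpace ℝ (Fin 3)) => (c N s x).1 + inner ℝ (c N s x).2.1 v + (c N s x).2.2 * ‖v‖ ^ 2 / 2 + (lam N)⁻¹ * κ N s x v; let L := fun (N : ℕ) (s : ℝ) (x : UnitAddTorus (Fin 3)) (v : EuclideanSpace ℝ (Fin 3)) => lam N * ∫ ω : Metric.sphere (0 : EuclideanSpace ℝ (Fin 3)) 1, (let y := G.translate x (ε N • (ω : EuclideanSpace ℝ (Fin 3))); ∫ w : EuclideanSpace ℝ (Fin 3), max (inner ℝ (v - w) ω) 0 * Y (σ ^ 3 * ρ s (G.translate x ((ε N / 2) • (ω : EuclideanSpace ℝ (Fin 3))))) * f s y w * (φ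 N s x (v - inner ℝ (v - w) ω • (ω : EuclideanSpace ℝ (Fin 3))) + φ N s y (w + inner ℝ (v - w) ω • (ω : EuclideanSpace ℝ (Fin 3))) - φ N s x v - φ N s y w)) ∂Literature.MathematicalPhysics.KineticTheory.sphereMeasure; let R := fun (N : ℕ) (z : Literature.Analysis.FluidPDE.Config (N + 1) (Fin 3) (UnitAddTorus (Fin 3))) => (let q := fun r : ℝ => (Φ N).flow r z; (N + 1 : ℝ)⁻¹ * (∑ᶠ (s : ℝ) (_ : s ∈ Literature.Analysis.FluidPDE.collisionTimes G (ε N) q ∩ Set.Ioc 0 t), ∑ i, ∑ j, (if i ≠ j ∧ ‖G.sepVec (q s i).1 (q s j).1‖ = ε N then φ N s (q s i).1 (q s i).2 - φ N s (q s i).1 (Literature.Analysis.FluidPDE.reflectVel (G.sepVec (q s i).1 (q s j).1) ((q s i).2, (q s j).2)).1 else 0)) - (∫ s in Set.Icc 0 t, ∫ y, L N s y.1 y.2 ∂(Literature.Analysis.FluidPDE.empiricalMeasure (q s))) + (1 / 2 : ℝ) * ∫ s in Set.Icc 0 t, ∫ x : UnitAddTorus (Fin 3), ∫ v : EuclideanSpace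 ℝ (Fin 3), f s x v * L N s x v); Filter.Tendsto (fun N : ℕ => ∫⁻ z, ENNReal.ofReal (R N z ^ 2) ∂(Literature.MathematicalPhysics.KineticTheory.localGibbsLaw σ (fun _ => a) (fun _ => uu) (fun _ => th) N (Φ N))) Filter.atTop (nhds 0)

/-- item stmt-AtomisticToContinuum-0768 · support · rank 9 · closed · proved by Summit.AtomisticToContinuum.HydrodynamicLimit.Theorems.hsEosLowDensity_proof (prover) · by planner
sources: Ruelle1969, LebowitzPenrose1964
[support] Hard-sphere equation of state at low density: ∃ η₀ > 0 and F real-analytic on (−η₀, η₀)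
with hsExcessFreeEnergy = F on [0, η₀), F(0) = 0, F'(0) = 2π/3 (second virial coefficient of
unit-diameter spheres), and the canonical thermodynamic limit −N⁻¹ log hsFreeVolume η N → F(η)
exists (not just limsup) for η ∈ [0, η₀). Ruelle1969 §3.4 (existence), LebowitzPenrose1964
(convergence of the virial expansion ⇒ analyticity). Makes hsCompressibility/hsPressure smooth and
Z(η) = 1 + (2π/3)η + O(η²); needed by every route (hyperbolicity of the Euler system, virial
theorem). -/
@[route_item "route-AtomisticToContinuum-EnskogAdjointDuality"]
def HsEosLowDensity : Prop :=
  ∃ η₀ : ℝ, 0 < η₀ ∧ ∃ F : ℝ → ℝ, AnalyticOnNhd ℝ F (Set.Ioo (-η₀) η₀) ∧ Set.EqOn Literature.MathematicalPhysics.KineticTheory.hsExcessFreeEnergy F (Set.Ico 0 η₀) ∧ F 0 = 0 ∧ deriv F 0 = 2 * Real.pi / 3 ∧ ∀ η ∈ Set.Ico 0 η₀, Filter.Tendsto (fun N : ℕ => -(N : ℝ)⁻¹ * Real.log (Literature.MathematicalPhysics.KineticTheory.hsFreeVolume η N)) Filter.atTop (nhds (F η))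

/-- `HsEosLowDensity` holds: proved by `Summit.AtomisticToContinuum.HydrodynamicLimit.Theorems.hsEosLowDensity_proof`. -/
theorem HsEosLowDensity_holds : HsEosLowDensity := _root_.Summit.AtomisticToContinuum.HydrodynamicLimit.Theorems.hsEosLowDensity_proof

-- earlier DualityReduction (stmt-AtomisticToContinuum-9170, replaced 2026-08-15T18:25:32Z -> stmt-AtomisticToContinuum-11590): retired by None — CollisionResidualVanishes → AdjointEnskogTestFamily → L2HydroFields
/-- item stmt-AtomisticToContinuum-11590 · support · rank 9 · closed · proved by Summit.AtomisticToContinuum.HydrodynamicLimit.Theorems.dualityReduction_proof @ f0121d999c01 (prover) · by planner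
sources: PulvirentiSimonella2016, Hoeffding1963, Spohn1991
[support] THE DUALITY GLUE (restated 2026-08-15; provable now, measure-theoretically heavy):
HsEosLowDensity → DiluteSelfConsistency → CollisionResidualVanishes → AdjointEnskogTestFamilyR →
L2HydroFields. Proof: from HsEosLowDensity pick η₁ > 0 with f_ex analytic, f_ex′ > 0, (ηZ)′ > 0 on
(0,η₁) (planner's EosWindow.lean `eos_window`, rc 0, attached as evidence); σ₀ := min of the σ₀'s of
K1, K2R(η₁), DiluteSelfConsistency(η₁); t = 0 is the hypothesis made L² (uniform integrability from
the Gaussian velocity marginal of the canonical law); for t > 0 the guard on [0,t] is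
DiluteSelfConsistency, K2R gives the family for smooth χ and each (a,b,e); on the good set of the
flow (law ≪ Liouville) the orbit is a right-continuous hard-sphere trajectory: piecewise FTC along
free flights + elastic jumps at the locally finite collision times give, for N large, ⟨ν_t,
χ·(a,b,e)⟩ = ⟨ν_0, φ^N_0⟩ + ∫⟨ν_s, g_s⟩ds + 𝓡_N − Res_N (ν = μ^N − f, g the defect); bound the four
terms in L²: t = 0 hypothesis + uniform convergence of c^N(0) + |κ|/λ_N ≤ C(1+|v|²)/λ_N; η_N·t·(1 +
2K_N/(N+1)) by energy conservation; K1; K2R (v); smooth χ → continuous χ by density and the same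
moment bound. [difficulty: provable-no -/
@[route_item "route-AtomisticToContinuum-EnskogAdjointDuality", crux]
def DualityReduction : Prop :=
  (∃ η₀ : ℝ, 0 < η₀ ∧ ∃ F : ℝ → ℝ, AnalyticOnNhd ℝ F (Set.Ioo (-η₀) η₀) ∧ Set.EqOn Literature.MathematicalPhysics.KineticTheory.hsExcessFreeEnergy F (Set.Ico 0 η₀) ∧ F 0 = 0 ∧ deriv F 0 = 2 * Real.pi / 3 ∧ ∀ η ∈ Set.Ico 0 η₀, Filter.Tendsto (fun N : ℕ => -(N : ℝ)⁻¹ * Real.log (Literature.MathematicalPhysics.KineticTheory.hsFreeVolume η N)) Filter.atTop (nhds (F η))) → (∀ η : ℝ, 0 < η → ∀ (a₀ θ₀ : Literature.MathematicalPhysics.KineticTheory.T3 → ℝ) (u₀ : Literature.MathematicalPhysics.KineticTheory.T3 → Literature.MathematicalPhysics.KineticTheory.V3), Continuous a₀ → Continuous θ₀ → Continuous u₀ → (∀ x, 0 < a₀ x) → (∀ x, 0 < θ₀ x) → ∃ σ₀ : ℝ, 0 < σ₀ ∧ ∀ σ : ℝ, 0 < σ → σ < σ₀ → ∀ (T : ℝ)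 (ρ θ : ℝ → Literature.MathematicalPhysics.KineticTheory.T3 → ℝ) (u : ℝ → Literature.MathematicalPhysics.KineticTheory.T3 → Literature.MathematicalPhysics.KineticTheory.V3), Literature.MathematicalPhysics.KineticTheory.IsHardSphereEulerSolution σ T ρ u θ → ∀ Φ : (N : ℕ) → Literature.Analysis.FluidPDE.HardSphereFlow (Literature.Analysis.FluidPDE.Torus.geometry (Fin 3)) (Literature.MathematicalPhysics.KineticTheory.hsDiameter σ N) (N + 1), Literature.MathematicalPhysics.KineticTheory.TendstoHydroFieldsAt (fun N => Literature.MathematicalPhysics.KineticTheory.localGibbsLaw σ a₀ u₀ θ₀ N (Φ N)) Φ ρ u θ 0 → ∀ t ∈ Set.Ico 0 T, ∀ x, ρ t x * σ ^ 3 < η) → CollisionResidualVanishes → AdjointEnskogTestFamilyR → L2HydroFields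

/-- item stmt-AtomisticToContinuum-17602 · support · rank 9 · closed · proved by Summit.AtomisticToContinuum.HydrodynamicLimit.Theorems.dualityReductionInBand_proof @ 29ea84786eff (prover) · by planner
sources: PulvirentiSimonella2016, Spohn1991, OllaVaradhanYau1993
[support] IN-BAND DUALITY GLUE TO THE STATEMENT (added 2026-08-16 after the D-0032 re-type of the
conjunct, p126922; provable-now — PROVED in the repairing planner's Sketch.lean, farm rc 0, 0
sorries, axioms {propext, Classical.choice, Quot.sound}, attached as evidence): HsEosLowDensity
(body inlined, as in DualityReduction) → CollisionResidualVanishes → AdjointEnskogTestFamilyR →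
HydrodynamicLimit (the PACKING-GUARDED conjunct, by name). The Statement's own guard ρ_t(x)σ³ < η₀
on [0,T)×𝕋³ discharges the K1/K2R packing guards with η₀ := the EOS window η₁ of
eos_window(HsEosLowDensity), so DiluteSelfConsistency is not needed and leaves the deciding theorem
(closes h₁ h₂ hE hD := hD hE h₁ h₂). Proof to land under Theorems/ (import
Theorems.EnskogAdjointDualityDualityReduction): intro hE h1 h2; ⟨η₁, hη₁, hA, hB, hC⟩ := eos_window
hE; refine ⟨η₁, hη₁, _⟩; given the profiles ⟨σc, hσc, hcore⟩ := smooth_core hη₁ hA hB hC h1 h2 …; σ₀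
:= min σc (1/2); intro σ hσ hσlt T ρ θ u hEul hguard Φ hLLN t ht — the Statement's hguard on [0,T)
IS smooth_core's guard premise; t = 0: tendsto_lintegral_sq_hydroCombo_zero; t > 0:
combo_tendsto_of_pos fed by hcore σ … Φ hLLN hguard t (verbatim the `hgen` bl -/
@[route_item "route-AtomisticToContinuum-EnskogAdjointDuality"]
def DualityReductionInBand : Prop :=
  (∃ η₀ : ℝ, 0 < η₀ ∧ ∃ F : ℝ → ℝ, AnalyticOnNhd ℝ F (Set.Ioo (-η₀) η₀) ∧ Set.EqOn Literature.MathematicalPhysics.KineticTheory.hsExcessFreeEnergy F (Set.Ico 0 η₀) ∧ F 0 = 0 ∧ deriv F 0 = 2 * Real.pi / 3 ∧ ∀ η ∈ Set.Ico 0 η₀, Filter.Tendsto (fun N : ℕ => -(N : ℝ)⁻¹ * Real.log (Literature.MathematicalPhysics.KineticTheory.hsFreeVolume η N)) Filter.atTop (nhds (F η))) → CollisionResidualVanishes → AdjointEnskogTestFamilyR → _root_.HydrodynamicLimit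

/-- item stmt-AtomisticToContinuum-9171 · support · rank 9 · closed · proved by Summit.AtomisticToContinuum.HydrodynamicLimit.Theorems.l2ToHydroLimit_proof_oneSphereInfluence @ 6acdbb9b5838 (prover) · by planner
sources: OllaVaradhanYau1993, Spohn1991
[support] Chebyshev glue with the ROOT-LEVEL conclusion (the sub-problem Statement decl
`HydrodynamicLimit`, an abbrev of the Literature constant; the proof attached to
stmt-AtomisticToContinuum-0801 applies verbatim up to `show`): mean-square convergence of the fields
implies convergence in probability, profile by profile (meas_ge_le_lintegral_div, measurability from
measurable_flow + continuity of χ). [difficulty: provable-now] -/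
@[route_item "route-AtomisticToContinuum-EnskogAdjointDuality"]
def L2ToHydroLimit : Prop :=
  L2HydroFields → _root_.HydrodynamicLimit

-- earlier Assembly (stmt-AtomisticToContinuum-11591, replaced 2026-08-16T23:55:16Z -> stmt-AtomisticToContinuum-18050): retired by None — CollisionResidualVanishes → AdjointEnskogTestFamilyR → HsEosLowDensity → DiluteSelfConsistency → _root_.HydrodynamicLimit
-- earlier Assembly (stmt-AtomisticToContinuum-9172, replaced 2026-08-15T18:25:32Z -> stmt-AtomisticToContinuum-11591): retired by None — CollisionResidualVanishes → AdjointEnskogTestFamily → _root_.HydrodynamicLimit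
/-- item stmt-AtomisticToContinuum-18050 · assembly · rank 1 · closed · proved by Summit.AtomisticToContinuum.HydrodynamicLimit.Theorems.enskogAdjointDuality_assembly_proof @ ecea6ceb0746 (prover) · by planner
sources: Spohn1991, OllaVaradhanYau1993, BGSR2017
[assembly] CRUX-ONLY ASSEMBLY (rev 13, 2026-08-17): CollisionResidualVanishes →
AdjointEnskogTestFamilyR → HydrodynamicLimit (the sub-problem Statement decl by name) — literally
the type of the deciding theorem `closes` (rev 12), hence proved by `theorem assembly_proof :
Assembly := closes` in any Theorems file importing this route file. Replaces the pre-D-0032 form K1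
→ K2R → HsEosLowDensity → DiluteSelfConsistency → HydrodynamicLimit (HsEosLowDensity is PROVED and
enters closes through HsEosLowDensity_holds; DiluteSelfConsistency is not load-bearing since the
Statement carries the packing guard). [deps: CollisionResidualVanishes, AdjointEnskogTestFamilyR]
[difficulty: provable-now] [Spohn1991, OllaVaradhanYau1993, BGSR2017] -/
@[route_item "route-AtomisticToContinuum-EnskogAdjointDuality"]
def Assembly : Prop :=
  CollisionResidualVanishes → AdjointEnskogTestFamilyR → _root_.HydrodynamicLimit

-- records of items no longer active in this route (dropped / restated):
-- earlier AdjointEnskogTestFamily (stmt-AtomisticToContinuum-9168, dropped 2026-08-15T18:27:25Z): refuted by Summit.AtomisticToContinuum.HydrodynamicLimit.Theorems.EnskogAdjointDualityAdjointEnskogTestFamily_refuted @ 61f90dc23865 — ∃ σ₀ : ℝ, 0 < σ₀ ∧ ∀ σ : ℝ, 0 < σ → σ < σ₀ → ∀ (T : ℝ) (ρ θ : ℝ → UnitAddTorus (Fin 3) → ℝ) (u : ℝ → UnitAddTorus (Fin 3) → EuclideanSpace ℝ (Fin 3)), Literature.Mathema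

/-! D-0027 §2.1 — DECIDING THEOREM (planner-authored via `route open/edit --closes-file`; by planner-rbadge-AtomisticToContinuum-EnskogAdjo-53553cdd-0 2026-08-16T23:53:20Z) — ARCHIVED: route closed (refuted) 2026-08-20T17:13:57Z; kept so importers keep building:
its hypotheses are this route's items and its conclusion the sub-problem Statement (glue_lint), and it elaborates with this file. -/

@[closes "route-AtomisticToContinuum-EnskogAdjointDuality"] theorem closes (h₁ : CollisionResidualVanishes) (h₂ : AdjointEnskogTestFamilyR) :
    _root_.HydrodynamicLimit := open Literature.Analysis.FluidPDE Literature.Analysis.FunctionSpaces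
  Literature.MathematicalPhysics.KineticTheory Summit.AtomisticToContinuum.HydrodynamicLimit.Theorems in by
  -- crux-only deciding theorem: the in-band duality glue is proved inline (see ## Assembly)
  obtain ⟨η₁, hη₁, hA, hB, hC⟩ := eos_window HsEosLowDensity_holds
  refine ⟨η₁, hη₁, fun a₀ θ₀ u₀ ha hθ hu ha0 hθ0 => ?_⟩
  obtain ⟨σ₁, hσ₁, h1'⟩ := h₁ η₁ hη₁ hA hB hC a₀ θ₀ u₀ ha hθ hu ha0 hθ0
  obtain ⟨σ₂, hσ₂, h2'⟩ := h₂ η₁ hη₁ hA hB hC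
  refine ⟨min (min σ₁ σ₂) (1 / 2), by positivity, ?_⟩
  intro σ hσ hσlt T ρ θ u hEul hgT Φ hLLN t htI
  have hσ₁' : σ < σ₁ := hσlt.trans_le ((min_le_left _ _).trans (min_le_left _ _))
  have hσ₂' : σ < σ₂ := hσlt.trans_le ((min_le_left _ _).trans (min_le_right _ _))
  have hσh : σ ≤ 1 / 2 := (hσlt.trans_le (min_le_right _ _)).le
  rcases htI.1.eq_or_lt with h0t | htpos
  · rw [← h0t]; exact hLLN
  have ht : t ∈ Ioo 0 T := ⟨htpos, htI.2⟩
  have hg' : ∀ s ∈ Icc 0 t, ∀ x, ρ s x * σ ^ 3 < η₁ := fun s hs x => hgT s ⟨hs.1, hs.2.trans_lt ht.2⟩ x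
  obtain ⟨hρc, huc, hθc, R, U, Θ, hρb, hub, hθb⟩ := eulerProfiles_window hEul ht.2
  have hρb' : ∀ s ∈ Icc 0 t, ∀ x, 0 ≤ ρ s x ∧ ρ s x ≤ R := fun s hs x => ⟨(hρb s hs x).1.le, (hρb s hs x).2⟩
  have slc : ∀ {F : Type} [TopologicalSpace F] {g : ℝ → T3 → F},
      ContinuousOn (uncurry g) (Icc 0 t ×ˢ univ) → ∀ s ∈ Icc 0 t, Continuous (g s) := fun hg s hs =>
    hg.comp_continuous (continuous_const.prodMk continuous_id) fun x => ⟨hs, mem_univ x⟩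
  have htt : t ∈ Icc 0 t := ⟨ht.1.le, le_rfl⟩
  have h00 : (0 : ℝ) ∈ Icc 0 t := ⟨le_rfl, ht.1.le⟩
  obtain ⟨CG, hCG0, hCG⟩ := exists_integral_one_add_norm_sq_sq_gaussMeasure_le U Θ
  obtain ⟨hYc, Ybar, hYb⟩ := contactValue_window (t := t) hσ hA hρc (fun s hs x => (hρb s hs x).1) hg'
  set P : (N : ℕ) → Measure (Config (N + 1) (Fin 3) T3) := fun N => localGibbsLaw σ a₀ u₀ θ₀ N (Φ N)
  refine tendstoHydroFieldsAt_of_isSmooth P Φ ρ u θ t (slc hρc t htt) (slc huc t htt) (slc hθc t htt)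
    (energy_tight_of_tendstoHydroFieldsAt_zero σ a₀ θ₀ u₀ Φ ρ θ u hLLN t) fun χ hχs δ hδ => ?_
  have hχ : Continuous χ := hχs.continuous
  set I₁ : ℝ := ∫ x, χ x * ρ t x
  set I₂ : V3 := ∫ x, (χ x * ρ t x) • u t x
  set I₃ : ℝ := ∫ x, χ x * totalEnergyDensity (ρ t x) (u t x) (θ t x)
  set W : ℝ → ℝ → V3 → (N : ℕ) → Config (N + 1) (Fin 3) T3 → ℝ := fun a e b N z =>
    a * (empiricalDensityField ((Φ N).flow t z) χ - I₁) +
      ⟪b, empiricalMomentumField ((Φ N).flow t z) χ - I₂⟫_ℝ +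
      e * (empiricalEnergyField ((Φ N).flow t z) χ - I₃) with hW
  have hWm : ∀ a e b N, Measurable (W a e b N) := fun a e b N =>
    measurable_hydroCombo_flow (Φ N) t hχ a e I₁ I₃ b I₂
  -- the smooth-χ L² core (verbatim the landed argument of `smooth_core`) in the fields form
  have hgen : ∀ (a e : ℝ) (b : V3),
      Tendsto (fun N => ∫⁻ z, ENNReal.ofReal (W a e b N z ^ 2) ∂P N) atTop (𝓝 0) := by
    intro a e b
    obtain ⟨c, κ, hc, hκ, ⟨C, hadm⟩, hrest⟩ := h2' σ hσ hσ₂' T ρ θ u hEul t ht hg' χ hχs a e b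
    extract_lets G₀ ε₀ lam f Y φ L at hrest
    obtain ⟨hterm, ⟨η, hη, hev⟩, ⟨c₀, hc₀, hconv⟩, hResT⟩ := hrest
    have h1'' := h1' σ hσ hσ₁' T ρ θ u hEul Φ hLLN t htI hg' c κ hc hκ ⟨C, hadm⟩
    have hφc : ∀ N, Continuous fun p : ℝ × T3 × V3 => φ N p.1 p.2.1 p.2.2 := by
      intro N
      have hcN : Continuous fun p : ℝ × T3 × V3 => c N p.1 p.2.1 :=
        (hc N).comp (continuous_fst.prodMk continuous_snd.fst)
      have h1c : Continuous fun p : ℝ × T3 × V3 => (c N p.1 p.2.1).1 := continuous_fst.comp hcN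
      have h21 : Continuous fun p : ℝ × T3 × V3 => (c N p.1 p.2.1).2.1 :=
        continuous_fst.comp (continuous_snd.comp hcN)
      have h22 : Continuous fun p : ℝ × T3 × V3 => (c N p.1 p.2.1).2.2 :=
        continuous_snd.comp (continuous_snd.comp hcN)
      show Continuous fun p : ℝ × T3 × V3 => (c N p.1 p.2.1).1 + ⟪(c N p.1 p.2.1).2.1, p.2.2⟫_ℝ +
        (c N p.1 p.2.1).2.2 * ‖p.2.2‖ ^ 2 / 2 + (lam N)⁻¹ * κ N p.1 p.2.1 p.2.2
      exact ((h1c.add (h21.inner continuous_snd.snd)).add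
        ((h22.mul (continuous_snd.snd.norm.pow 2)).div_const 2)).add (continuous_const.mul (hκ N))
    have hφb : ∀ N s x v, |φ N s x v| ≤ (3 * C + |(lam N)⁻¹| * C) * (1 + ‖v‖ ^ 2) := fun N s x v =>
      abs_testFn_le v (hadm N s x x v v).1 (hadm N s x x v v).2.2.1
    have hπc : Continuous fun s : ℝ => max 0 (min t s) := continuous_const.max (continuous_const.min continuous_id)
    have hLfacts : ∀ N, ∃ K : ℝ, (∀ s ∈ Icc 0 t, ∀ x v, |L N s x v| ≤ K * (1 + ‖v‖ ^ 2) ^ 2) ∧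
        Measurable fun p : ℝ × T3 × V3 => L N (max 0 (min t p.1)) p.2.1 p.2.2 := by
      intro N
      obtain ⟨K, -, hK⟩ := abs_enskogL_le (t := t)
        (Yf := fun s x' => 3 / (2 * Real.pi) * deriv hsExcessFreeEnergy (σ ^ 3 * ρ s x'))
        (g := ρ) (θf := θ) (uf := u) (φ := φ N) (xs := fun x ω => G₀.translate x ((ε₀ N / 2) • (ω : V3)))
        (ys := fun x ω => G₀.translate x (ε₀ N • (ω : V3))) (Ybar := Ybar) (R := R) (U := U) (Θ := Θ)
        (Cφ := 3 * C + |(lam N)⁻¹| * C) (lam := lam N) hYb hρb' hub hθb (fun s _ x v => hφb N s x v) (L N)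
        (fun s x v => rfl)
      refine ⟨K, hK, ?_⟩
      have hsm1 : Continuous fun p : T3 × Metric.sphere (0 : V3) 1 => (ε₀ N / 2) • (p.2 : V3) := by
        fun_prop
      have hsm2 : Continuous fun p : T3 × Metric.sphere (0 : V3) 1 => ε₀ N • (p.2 : V3) := by fun_prop
      have hxs : Continuous (uncurry fun (x : T3) (ω : Metric.sphere (0 : V3) 1) =>
          G₀.translate x ((ε₀ N / 2) • (ω : V3))) := by
        show Continuous fun p : T3 × Metric.sphere (0 : V3) 1 => p.1 + Torus.proj ((ε₀ N / 2) • (p.2 : V3))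
        exact continuous_fst.add (Torus.continuous_proj.comp hsm1)
      have hys : Continuous (uncurry fun (x : T3) (ω : Metric.sphere (0 : V3) 1) =>
          G₀.translate x (ε₀ N • (ω : V3))) := by
        show Continuous fun p : T3 × Metric.sphere (0 : V3) 1 => p.1 + Torus.proj (ε₀ N • (p.2 : V3))
        exact continuous_fst.add (Torus.continuous_proj.comp hsm2)
      exact measurable_enskogL_of_continuous
        (Yf := fun s x' => 3 / (2 * Real.pi) * deriv hsExcessFreeEnergy (σ ^ 3 * ρ (max 0 (min t s)) x'))
        (g := fun s => ρ (max 0 (min t s))) (θf := fun s => θ (max 0 (min t s)))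
        (uf := fun s => u (max 0 (min t s))) (φ := fun s => φ N (max 0 (min t s)))
        (xs := fun x ω => G₀.translate x ((ε₀ N / 2) • (ω : V3)))
        (ys := fun x ω => G₀.translate x (ε₀ N • (ω : V3))) (lam := lam N)
        (continuous_frozen (g := fun s x' => 3 / (2 * Real.pi) * deriv hsExcessFreeEnergy (σ ^ 3 * ρ s x'))
          ht.1.le hYc) (continuous_frozen ht.1.le hρc) (continuous_frozen ht.1.le hθc)
        (fun s x => (hθb _ (Literature.MathematicalPhysics.QuantumLattice.clamp_mem_Icc ht.1.le s) x).1) (continuous_frozen ht.1.le huc)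
        ((hφc N).comp ((hπc.comp continuous_fst).prodMk continuous_snd)) hxs hys
        (fun s => L N (max 0 (min t s))) (fun s x v => rfl)
    have hfrozc : Continuous fun p : ℝ × T3 × V3 => f (max 0 (min t p.1)) p.2.1 p.2.2 := by
      have hq : Continuous fun p : ℝ × T3 × V3 => ((p.1, p.2.1) : ℝ × T3) := continuous_fst.prodMk continuous_snd.fst
      show Continuous fun p : ℝ × T3 × V3 => ρ (max 0 (min t p.1)) p.2.1 *
        localMaxwellian 1 (θ (max 0 (min t p.1)) p.2.1) (u (max 0 (min t p.1)) p.2.1) p.2.2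
      exact ((continuous_frozen ht.1.le hρc).comp hq).mul (continuous_localMaxwellian_param
        ((continuous_frozen ht.1.le hθc).comp hq) (fun p => (hθb _ (Literature.MathematicalPhysics.QuantumLattice.clamp_mem_Icc ht.1.le p.1) p.2.1).1)
        ((continuous_frozen ht.1.le huc).comp hq) continuous_snd.snd)
    let Dφ : ℕ → ℝ → T3 → V3 → ℝ := fun N s x v =>
      derivWithin (fun r => φ N r (G₀.translate x ((r - s) • v)) v) (Icc 0 t) s
    let F : ℕ → ℝ := fun N => (∫ s in Icc 0 t, ∫ x, ∫ v, f s x v * (Dφ N s x v + (1 / 2 : ℝ) * L N s x v)) +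
      (1 / 2 : ℝ) * ∫ s in Icc 0 t, ∫ x, ∫ v, f s x v * L N s x v
    have hFb : ∀ᶠ N in atTop, |F N| ≤ η N * (t * (R * CG)) := by
      filter_upwards [hev] with N hN
      obtain ⟨-, hdef⟩ := hN
      obtain ⟨K, hKb, hKm⟩ := hLfacts N
      have hη0 : 0 ≤ η N := by simpa using (abs_nonneg _).trans (hdef 0 h00 0 0)
      exact abs_I3_add_half_I2_le ht.1 hρb' hub hθb hCG (f := f) (fun s x v => rfl)
        (Φf := fun p => f (max 0 (min t p.1)) p.2.1 p.2.2) hfrozc.measurable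
        (fun s hs x v => by simp only [Literature.MathematicalPhysics.QuantumLattice.clamp_eq_self hs]) (Dφ N) (L N)
        (Dm := fun p => deriv (fun r => φ N r (G₀.translate p.2.1 ((r - p.1) • p.2.2)) p.2.2) p.1)
        (Lm := fun p => L N (max 0 (min t p.1)) p.2.1 p.2.2) (measurable_charDeriv (hφc N)) hKm
        (fun s hs x v => derivWithin_charDeriv_eq_deriv hs x v)
        (fun s hs x v => by simp only [Literature.MathematicalPhysics.QuantumLattice.clamp_eq_self hs]) hKb hη0 hdef
    have hF : Tendsto F atTop (𝓝 0) := by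
      refine squeeze_zero_norm' (hFb.mono fun N h => ?_) (by simpa using hη.mul_const (t * (R * CG)))
      rw [Real.norm_eq_abs]; exact h
    have h0 := initial_term_tendsto ha hθ hu ha0 hθ0 hσh Φ hLLN (slc hρc 0 h00) (slc huc 0 h00)
      (slc hθc 0 h00) (fun x => (hθb 0 h00 x).1) (fun x => (hρb 0 h00 x).1.le) c κ hc hκ (C := C)
      (fun N s x v => ⟨(hadm N s x x v v).1, (hadm N s x x v v).2.2.1⟩) (fun N => (lam N)⁻¹)
      (tendsto_lamInv_zero hσ) hc₀ hconv φ (fun N s x v => rfl) f (fun s x v => rfl)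
    have hmain := duality_assembly ha hθ hu ha0 hθ0 hσh Φ ht.1 φ L f _ hφc ⟨η, hη, hev⟩ hLfacts
      (fun N z => rfl) h1'' hResT hF h0
    refine hmain.congr fun N => lintegral_congr fun z => ?_
    have hI : (∫ x, ∫ v, f t x v * (χ x * (a + ⟪b, v⟫_ℝ + e * ‖v‖ ^ 2 / 2))) =
        a * I₁ + ⟪b, I₂⟫_ℝ + e * I₃ :=
      integral_ft_chi_affine_eq_combo (slc hρc t htt) (slc huc t htt) (slc hθc t htt)
        (fun x => (hθb t htt x).1) hχ a e b
    simp only [hterm, hW]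
    rw [avg_chi_affine_eq_combo, hI, inner_sub_right]
    congr 1; ring
  -- Chebyshev along the local Gibbs laws
  have hWp : ∀ (a e : ℝ) (b : V3) {d : ℝ}, 0 < d →
      Tendsto (fun N => P N {z | d < |W a e b N z|}) atTop (𝓝 0) := by
    intro a e b d hd
    have hd2 : ENNReal.ofReal (d ^ 2) ≠ 0 := by rw [Ne, ENNReal.ofReal_eq_zero, not_le]; positivity
    have hl : Tendsto (fun N => (∫⁻ z, ENNReal.ofReal (W a e b N z ^ 2) ∂P N) / ENNReal.ofReal (d ^ 2))
        atTop (𝓝 0) := by simpa using ENNReal.Tendsto.div_const (hgen a e b) (Or.inr hd2)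
    refine tendsto_of_tendsto_of_tendsto_of_le_of_le tendsto_const_nhds hl (fun N => bot_le) fun N => ?_
    refine (measure_mono fun z (hz : d < |W a e b N z|) => ?_).trans (meas_ge_le_lintegral_div
      ((hWm a e b N).pow_const 2).ennreal_ofReal.aemeasurable hd2 ENNReal.ofReal_ne_top)
    refine ENNReal.ofReal_le_ofReal ?_
    rw [← sq_abs (W a e b N z)]
    exact pow_le_pow_left₀ hd.le hz.le 2
  refine ⟨?_, ?_, ?_⟩
  · refine (hWp 1 0 0 hδ).congr fun N => ?_
    congr 1; ext z; simp [hW]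
  · have hk : ∀ l : Fin 3, Tendsto (fun N => P N {z | δ / 3 <
        |(empiricalMomentumField ((Φ N).flow t z) χ - I₂) l|}) atTop (𝓝 0) := fun l => by
      refine (hWp 0 0 (EuclideanSpace.single l (1 : ℝ)) (by positivity : 0 < δ / 3)).congr fun N => ?_
      congr 1; ext z; simp [hW, EuclideanSpace.inner_single_left]
    have hs : Tendsto (fun N => ∑ l : Fin 3, P N {z | δ / 3 <
        |(empiricalMomentumField ((Φ N).flow t z) χ - I₂) l|}) atTop (𝓝 0) := by
      simpa using tendsto_finsetSum Finset.univ fun l _ => hk l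
    exact tendsto_of_tendsto_of_tendsto_of_le_of_le tendsto_const_nhds hs (fun N => bot_le) fun N =>
      measure_setOf_lt_norm_le (P N) (fun z => empiricalMomentumField ((Φ N).flow t z) χ - I₂) hδ.le
  · refine (hWp 0 1 0 hδ).congr fun N => ?_
    congr 1; ext z; simp [hW]

end Summit.AtomisticToContinuum.HydrodynamicLimit.Theses.EnskogAdjointDuality
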